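import Literature.MathematicalPhysics.QuantumFieldTheory.Balaban1983to89.B3Ineq25SmoothLocalization

/-!
# Bałaban, *(Higgs)₂,₃ quantum fields in a finite volume III. Renormalization* [B3] — the norm (1.32) p. 420 of a smoothly localized
# two-variable kernel `(h ⊗ h′)·F` for a NON-SYMMETRIC kernel `F` = the kernel of an arbitrary operator `T` on the scalar fields, read through
# `T` (row family) and its (1.5)-adjoint `T′` (column family): the multiplier of p. 420 with TWO block families

statement-level skeleton of published theorems with citation tags; proofs where landed; nothing here is a claim about the Yang–Mills mass gap

T. Bałaban, Commun. Math. Phys. **88** (1983) 411–445 [cite: Balaban1983Higgs3].  PDF held: `paper:balaban1983-higgs-2-3-quantum-fields-finite-volume`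
(journal page = PDF page + 410), p. 414 [PDF 4], p. 420 [PDF 10], p. 424 [PDF 14].

CITATION HEADER (lean-in-tree rule).  Cell `lit-balaban` (HOME `run/shared/lean/pub/lit-balaban/`), Phase-2 proof seat **p40** gen 72 (unit
`lit-balaban-p40`; TAKING line HOME/STATUS.md 2026-08-23T04:01:59Z); SKELETON rows **B3.Eq2.5** / **B3.Eq1.16** (fold owner r15; decl of record
`B3Sect2StatementsPart2.ScaledKernels.Ineq25At`), owner item `B3-CLOSURE.md` v1.22 §5 item 11 = FILE 5 of r14 g19's programme for the ANALYTIC HALF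
of (1.16) (`DESIGN-B3-116-analytic.md`): the (1.32) two-variable-norm assembly `norm116` ⇒ `Ineq25At n n'`.  THIS FILE is the engine of FILE 5(a):
p33 g61's abstract multiplier `B3Norm132SmoothMultiplier` (p348617) — itself p40 g69's §III of `B3Ineq31SmoothLocalization` (p345208) with the blocks
abstracted — carried from ONE block family to TWO, because the kernel of the operator (1.16) `[G_k(Ω,B̃)V_k]^n G_k(Ω,Ã+B̃)[V_kG_k(Ω,B̃)]^{n′}` is NOT
symmetric for `n ≠ n′` (its (1.5)-adjoint is the operator with `n` and `n′` exchanged, p40 g70 `B3Eq116TwoSidedExpansion.star_term116`), whereas the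
one-family reading (column blocks `KV x′ x`) is the transposed field only for symmetric kernels (`δG_k`: p33 `B3Ineq25SmoothLocalization.star_kvD`;
`G_k`: p40).  USED BY NAME, never restated: p33's `kerM`, `norm_kerM_le`, `norm_derivM_core`, `holder_core_mulG`, `isSmoothLoc_of_lip`, `DomD`,
`setDist`; p40's `IsSmoothLoc`, `dEta`, `coefA`, `coefB`, `smoothConst`, `PSite`/`PBd`/`hb`/`dirOf`/`baseOf`/`pdist`/`transp`/`cpath`/`unitV`/`unitD`;
p35's chain transport `hol`, `norm_hol_apply_sub_le`; p40/p33 g58's dipole calculus `dip`, `onb`, `siteInner_dip`, `siteInner_single_right`; the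
printed SUM form (1.32) `B3Sect1Statements.norm132`; the typer's `HiggsCovariance.kernel`.

## What is printed (verbatim)

(1.32) p. 420 [PDF 10]: *"‖f‖_{1,α} = sup_x|f(x)| + sup_{x,μ}|(D^η_{B̃,μ}f)(x)| + sup_{x,x′,μ}|x − x′|^{−α}|U(B̃(Γ_{x,x′}))(D^η_{B̃,μ}f)(x′) − (D^η_{B̃,μ}f)(x)|,
(1.32) where Γ_{x,x′} is a shortest contour connecting x and x′. This definition extends in a natural way to functions of many variables."*;
(1.16) p. 414 [PDF 4]: *"[G_k(Ω,B̃)V_k(Ã,B̃)]^n G_k(Ω,Ã+B̃)[V_k(Ã,B̃)G_k(Ω,B̃)]^{n′}, (1.16) … for n, n′ sufficiently large, a kernel of the operator (1.16)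
is a sufficiently regular function of both variables. More exactly the Hölder norms of the covariant derivatives of this kernel, the norms defined for
example in the inequalities (I.2.24) and (I.2.25) of Proposition I.2.1, are exponentially decaying with the distance of the arguments"*;
(2.5) p. 424 [PDF 14]: *"‖h(an operator δG_k(Ω,Ω₂,B̃) or (1.16))h′‖_{1,α} ≤ O(e^{−δ₀dist(Ω₂,∂Ω)} or (e(L^kε)p(L^kε))^{n+n′})e^{−δ₀dist(supp h, supp h′)}, (2.5)
where h, h′ are functions giving the localizations of the vertices."*

## What this file proves, and how

§1 THE BLOCKS OF AN ARBITRARY OPERATOR `T` on the scalar fields of `T_ε` (`HiggsCovariance.kernel`): value blocks `vblk T x y : v ↦ (Tδ_y v)(x)`, the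
ROW-differentiated blocks `dblk T b y : v ↦ (D^ε_A Tδ_y v)(b)`, their column-sum bounds, the row move of `dblk` below the column sums; and, for a pair
`(T, T′)` ADJOINT for the scalar product (I.1.5) (`⟨f, Tg⟩ = ⟨T′f, g⟩`, a HYPOTHESIS `hadj` here — discharged for (1.16) in the companion file):
`⟨w, (Tδ_{x′}v)(x)⟩ = ⟨(T′δ_x w)(x′), v⟩` (`inner_vblk_comm`), `vblk T x y^* = vblk T′ y x` (`star_vblk`: THE COLUMN READING OF THE FIELD `F(x,y) = vblk T x y`
IS THE ROW READING OF `T′`), `⟨w, (D^ε_ATδ_{x′}v)(b)⟩ = ε^{−1}⟨(T′dip_b w)(x′), v⟩` (`inner_dblk_single`), and the three path lemmas: row move of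
values (`norm_hol_comp_vblk_sub_le`, field `Tδ_y v`), column move of values (`norm_vblk_comp_star_sub_le`, field `T′δ_x w`), column move of the
row-differentiated blocks (`norm_dblk_comp_star_sub_le`, field `T′dip_b w`) — p33 g60's `B3Ineq25RegularNested` §1 with the symmetry of `δG_k`
replaced by the adjoint pair.
§2 THE TWO-FAMILY MULTIPLIER: for block families `(KV, KD)` (row reading: differentiated variable = the first) and `(KV′, KD′)` (column reading), the
localized field `kerM KV h h′` (p33), its product-rule derivatives `derivM2` (`coefA•KD + coefB•KV` on row bonds, `coefA•KD′ + coefB•KV′` on column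
bonds) and its (1.32) norm `normM2` on the whole product lattice; `normM2_le`: `‖(h ⊗ h′)F‖_{1,α} ≤ K(c₁,c₂,d,m)·B + B_H` from the EIGHT block bounds
(p33's `normM_le` verbatim per branch: four bounds on `(S,S′)` for `(KV,KD)`, four on `(S′,S)` for `(KV′,KD′)`), `K = smoothConst`.
§3 THE EIGHT BLOCK BOUNDS FROM KERNEL ENTRIES on a pair of p33-admissible domains, for the blocks IN THE PRINT'S `η`-UNITS `kv T = unitV•vblk T`,
`kd T = unitD•dblk T` (`unitV = (L^kε)^{d−2}ε^{−d}`, `unitD = (L^kε)^{d−1}ε^{−d}`, p40 g68): from the four p33-shape kernel entries of `T` AND of `T′` at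
«good» points (an arbitrary predicate `Good`; interior points of a region in the companion) — value `(ε^d)^{−1}Σ_{i′}‖(Te_{(x′,i′)})(x)‖ ≤
C_V(L^kε)²((L^kε)^d)^{−1}e^{−δ|x−x′|/L^k}`, row derivative (`C_D(L^kε)((L^kε)^d)^{−1}`), transported Hölder difference of the row derivative along admissible
contours (`(ε|x₁−x₂|)^α·C_H(L^kε)((L^kε)^d)^{−1}((L^kε)^α)^{−1}`, rate on `min(|x₁−x′|,|x₂−x′|)`), mixed `(ε^d)^{−1}ε^{−1}Σ_i‖(D^ε_AT dip_{⟨x′,ν⟩}e_i)(⟨x,μ⟩)‖ ≤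
C_M((L^kε)^d)^{−1}e^{−δ…}` — with NO boundary factors: `bounds_packG` (values/derivatives `≤ (C_V + C_D)e^{−δD}`, joint Hölder `≤ (C_H + dmC_M)e^{−δD}p^α`,
value moves `≤ d(|Δx|+|Δy|)/L^k·(C_V+C_D)e^{−δD}` on a domain pair at lattice distance `≥ DL^k`), and **`normM2_le_of_entries`**: for smooth `h, h′` of
p40's class supported with collar in the two domains, `normM2 … (kv T)(kd T)(kv T′)(kd T′) α h h′ ≤ (K(c₁,c₂+2c₁,d,m)(C_V+C_D) + C_H + dmC_M)·e^{−δD}`.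

## Honest scope

Pure lattice algebra on the carrier of record (`HiggsLattice.Params`, `ε`-lattice `T_ε`, `N`-component scalar fields, background `A` entering only
the covariant derivatives (I.1.7) and the transports): no propagator, no region, no regularity enters; the adjointness of `(T, T′)` and the eight
kernel entries are HYPOTHESES, discharged by the instances (companion `B3Ineq25Op116Smooth`: `T = op116 … n n′`, `T′ = op116 … n′ n`).  Domains =
p33's (contour-closed, diameter `≤ mL^k`, good points); contours = `cpath`; `|·|` of a block = operator norm.  No `def … : Prop`, no named fact (all
`def`s are concrete data); axioms standard.  Value = the reusable multiplier step for the (1.16) alternative of (2.5), NOT summit progress.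
-/

noncomputable section

open scoped BigOperators InnerProductSpace Matrix

namespace Literature.MathematicalPhysics.QuantumFieldTheory.Balaban1983to89.B3Norm132TwoFamilyMultiplier

open HiggsLattice (ChargeData ScalarField siteInner covDeriv)
open HiggsCovariance (E)
open B1Eq230FluctCov (Ix cb)
open B1Eq221Coordinates (fieldCoord)
open B1Ineq234Concrete (tdist_self)
open B1Ineq234LevelZero (tdist_comm)
open B1TorusChainTransport (IsTChain hol norm_hol_apply_sub_le hol_nil)
open B4GaugeCovariance (pathEnd)
open B3Sect1Statements (norm132)
open LatticeNorms (supNorm_le holderSeminorm_le)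
open B3Ineq210RegularTorus (mesh_eq_pow_mul)
open B3Ineq211RegularTorus (IsAdm norm_hol_covDeriv_sub_le_sum_coord)
open B3Ineq210MixedRegularTorus (onb dip norm_covDeriv_dip_le_sum norm_apply_single_le norm_covDeriv_apply_single_le siteInner_single_right
  siteInner_dip abs_fieldCoord_single_le fieldCoord_single_of_ne)
open B3Ineq31RegularTorus (cpath isAdm_cpath pathEnd_cpath cpath_self PSite PBd hb dirOf baseOf pdist unitV unitD transp norm_hol_comp_le)
open B3Ineq31SmoothLocalization (dEta IsSmoothLoc fd fo coefA coefB smoothConst smoothConst_pos)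
open B3Norm132SmoothMultiplier (kerM norm_kerM_le norm_derivM_core holder_core_mulG isSmoothLoc_of_lip)
open B3Ineq25SmoothLocalization (DomD)

variable {P : HiggsLattice.Params} {N : ℕ}

/-! ## §0 Arithmetic of the units -/

section Units

variable {k : ℕ}

/-- `unitV > 0`. [folklore] -/
private theorem unitV_pos (P : HiggsLattice.Params) (k : ℕ) : 0 < unitV P k := by
  unfold unitV; have := P.mesh_pos k; have := P.mesh_pos 0; positivity

/-- `unitD > 0`. [folklore] -/
private theorem unitD_pos (P : HiggsLattice.Params) (k : ℕ) : 0 < unitD P k := by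
  unfold unitD; have := P.mesh_pos k; have := P.mesh_pos 0; positivity

/-- monotonicity of a decay factor in the distance. [folklore] -/
private theorem exp_dist_mono {δ s s' : ℝ} (hδ : 0 ≤ δ) (h : s' ≤ s) : Real.exp (-(δ * s)) ≤ Real.exp (-(δ * s')) :=
  Real.exp_le_exp.mpr (neg_le_neg (mul_le_mul_of_nonneg_left h hδ))

/-- `unitV·ε = unitD/L^k`. [folklore] -/
private theorem unitV_mul_mesh (P : HiggsLattice.Params) (k : ℕ) : unitV P k * P.mesh 0 = unitD P k * ((P.L : ℝ) ^ k)⁻¹ := by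
  unfold unitV unitD
  rw [mesh_eq_pow_mul P k]
  have hε : P.mesh 0 ≠ 0 := (P.mesh_pos 0).ne'
  have hL : (P.L : ℝ) ^ k ≠ 0 := pow_ne_zero _ (by have := P.hL; positivity)
  field_simp

/-- **An operator norm from its bilinear form**: `|⟨w, Xv⟩| ≤ B‖v‖‖w‖` for all `v, w` gives `‖X‖ ≤ B`. [folklore] -/
private theorem opNorm_le_of_inner_le (X : E N →L[ℝ] E N) {B : ℝ} (hB : 0 ≤ B) (h : ∀ v w : E N, |⟪w, X v⟫_ℝ| ≤ B * ‖v‖ * ‖w‖) :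
    ‖X‖ ≤ B := by
  refine ContinuousLinearMap.opNorm_le_bound _ hB fun v => ?_
  have h1 := h v (X v)
  rw [real_inner_self_eq_norm_sq, abs_of_nonneg (sq_nonneg _)] at h1
  by_cases h0 : ‖X v‖ = 0
  · rw [h0]; positivity
  · have hpos : 0 < ‖X v‖ := lt_of_le_of_ne (norm_nonneg _) (Ne.symm h0)
    nlinarith

end Units

/-! ## §1 The blocks of the kernel of an arbitrary operator `T` on the scalar fields, and of an adjoint pair `(T, T′)` -/

section Blocks

variable (C : ChargeData N) (A : HiggsLattice.VecField P 0) (T : Module.End ℝ (ScalarField P 0 N))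

/-- The `N × N` block `F(x,y) = T(x,y) : v ↦ (Tδ_y v)(x)` of the kernel of `T`, as a map of `ℝ^N` (the typer's `HiggsCovariance.kernel`).
[cite: Balaban1983Higgs3, (1.16) p.414, (2.5) p.424] -/
def vblk (x y : HiggsLattice.Site P 0) : E N →L[ℝ] E N :=
  LinearMap.toContinuousLinearMap (HiggsCovariance.kernel T x y)

/-- The ROW-DIFFERENTIATED block `v ↦ (D^ε_A Tδ_y v)(b) = ε^{−1}(U(εA_b)T(b₊,y) − T(b₋,y))v`.
[cite: Balaban1982Higgs1, (1.7) p.605] [cite: Balaban1983Higgs3, (1.32) p.420] -/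
def dblk (b : HiggsLattice.PBond P 0) (y : HiggsLattice.Site P 0) : E N →L[ℝ] E N :=
  (P.mesh 0)⁻¹ • ((C.U (P.mesh 0) (A b)).comp (vblk T b.tgt y) - vblk T b.src y)

variable {C A T}

/-- `T(x,y)v = (Tδ_y v)(x)`. [cite: Balaban1983Higgs3, (1.16) p.414] -/
theorem vblk_apply (x y : HiggsLattice.Site P 0) (v : E N) : vblk T x y v = T (Pi.single y v) x := by
  simp [vblk, HiggsCovariance.kernel]

/-- `(DT)(b,y)v = (D^ε_A Tδ_y v)(b)`. [cite: Balaban1982Higgs1, (1.7) p.605] -/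
theorem dblk_apply (b : HiggsLattice.PBond P 0) (y : HiggsLattice.Site P 0) (v : E N) :
    dblk C A T b y v = covDeriv C A (T (Pi.single y v)) b := by
  simp only [dblk, _root_.smul_apply, _root_.sub_apply, ContinuousLinearMap.comp_apply, vblk_apply]
  rfl

/-- `‖T(x,y)‖ ≤ Σ_{i′}‖(Te_{(y,i′)})(x)‖` (operator norm below the column sum). [cite: Balaban1983Higgs3, (2.5) p.424] -/
theorem norm_vblk_le (x y : HiggsLattice.Site P 0) : ‖vblk T x y‖ ≤ ∑ i' : Ix N, ‖T (cb P N 0 (y, i')) x‖ := by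
  refine ContinuousLinearMap.opNorm_le_bound _ (Finset.sum_nonneg fun _ _ => norm_nonneg _) fun v => ?_
  rw [vblk_apply, mul_comm]
  exact norm_apply_single_le _ y v x

/-- `‖(DT)(b,y)‖ ≤ Σ_{i′}‖(D^ε_ATe_{(y,i′)})(b)‖`. [cite: Balaban1983Higgs3, (2.5) p.424] -/
theorem norm_dblk_le (b : HiggsLattice.PBond P 0) (y : HiggsLattice.Site P 0) :
    ‖dblk C A T b y‖ ≤ ∑ i' : Ix N, ‖covDeriv C A (T (cb P N 0 (y, i'))) b‖ := by
  refine ContinuousLinearMap.opNorm_le_bound _ (Finset.sum_nonneg fun _ _ => norm_nonneg _) fun v => ?_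
  rw [dblk_apply, mul_comm]
  exact norm_covDeriv_apply_single_le C A _ y v b

/-- **The row move of the row-differentiated blocks, below the column sums**:
`‖U(A(Γ))(DT)(⟨x₂,μ⟩,y) − (DT)(⟨x₁,μ⟩,y)‖ ≤ Σ_{i′}‖U(A(Γ))(D^ε_ATe_{(y,i′)})(⟨x₂,μ⟩) − (D^ε_ATe_{(y,i′)})(⟨x₁,μ⟩)‖`. [cite: Balaban1983Higgs3, (1.32) p.420] -/
theorem norm_hol_comp_dblk_sub_le (x₁ x₂ y : HiggsLattice.Site P 0) (Γ : List (HiggsLattice.Site P 0)) (μ : Fin P.d) :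
    ‖(hol C A x₁ Γ).comp (dblk C A T ⟨x₂, μ⟩ y) - dblk C A T ⟨x₁, μ⟩ y‖
      ≤ ∑ i' : Ix N, ‖hol C A x₁ Γ (covDeriv C A (T (cb P N 0 (y, i'))) ⟨x₂, μ⟩) - covDeriv C A (T (cb P N 0 (y, i'))) ⟨x₁, μ⟩‖ := by
  refine ContinuousLinearMap.opNorm_le_bound _ (Finset.sum_nonneg fun _ _ => norm_nonneg _) fun v => ?_
  rw [_root_.sub_apply, ContinuousLinearMap.comp_apply, dblk_apply, dblk_apply, mul_comm]
  refine (norm_hol_covDeriv_sub_le_sum_coord C A _ _ x₁ x₂ Γ μ).trans ?_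
  rw [Fintype.sum_prod_type, Finset.sum_eq_single y, Finset.mul_sum]
  · exact Finset.sum_le_sum fun i' _ => mul_le_mul_of_nonneg_right (abs_fieldCoord_single_le y v _) (norm_nonneg _)
  · intro x _ hx
    exact Finset.sum_eq_zero fun i' _ => by rw [fieldCoord_single_of_ne y v (s := (x, i')) hx, abs_zero, zero_mul]
  · intro h; exact absurd (Finset.mem_univ y) h

/-- **The row move of VALUES**: for a chain `Γ` from `x₁` inside a set `S_b` on whose bonds `‖(DT)(b, y)‖ ≤ M` for the fixed other site `y`,
`‖U(A(Γ))T(end Γ,y) − T(x₁,y)‖ ≤ ε|Γ|M` (p35's path lemma on the field `Tδ_y v`). [cite: Balaban1983Higgs3, (1.32) p.420]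
[cite: Balaban1983RegularityDecay, p.578] -/
theorem norm_hol_comp_vblk_sub_le (hS : ∀ μ, 2 < P.sitesPerDir 0 μ) (y : HiggsLattice.Site P 0)
    (Sb : Finset (HiggsLattice.Site P 0)) {Mx : ℝ} (hMx : 0 ≤ Mx)
    (hD : ∀ (b : HiggsLattice.PBond P 0), b.src ∈ Sb → b.tgt ∈ Sb → ‖dblk C A T b y‖ ≤ Mx)
    {x₁ : HiggsLattice.Site P 0} {Γ : List (HiggsLattice.Site P 0)} (hch : IsTChain x₁ Γ) (hΓ : ∀ z ∈ x₁ :: Γ, z ∈ Sb) :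
    ‖(hol C A x₁ Γ).comp (vblk T (pathEnd x₁ Γ) y) - vblk T x₁ y‖ ≤ P.mesh 0 * Γ.length * Mx := by
  have hε : 0 < P.mesh 0 := P.mesh_pos 0
  refine ContinuousLinearMap.opNorm_le_bound _ (by positivity) fun v => ?_
  set φ : ScalarField P 0 N := T (Pi.single y v) with hφ
  rw [_root_.sub_apply, ContinuousLinearMap.comp_apply, vblk_apply, vblk_apply]
  have hpath := norm_hol_apply_sub_le hS C A φ Sb (G := Mx * ‖v‖)
    (fun z μ hz hzμ => by
      rw [hφ, ← dblk_apply]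
      exact (ContinuousLinearMap.le_opNorm _ _).trans (mul_le_mul_of_nonneg_right (hD ⟨z, μ⟩ hz hzμ) (norm_nonneg _)))
    hch hΓ
  calc ‖hol C A x₁ Γ (φ (pathEnd x₁ Γ)) - φ x₁‖ ≤ P.mesh 0 * Γ.length * (Mx * ‖v‖) := hpath
    _ = P.mesh 0 * Γ.length * Mx * ‖v‖ := by ring

/-! ### An adjoint pair `(T, T′)` for the scalar product (I.1.5) -/

variable {T' : Module.End ℝ (ScalarField P 0 N)}

/-- **The column slice of the kernel of `T` is the row slice of the kernel of its adjoint**: `⟨w, (Tδ_{x′}v)(x)⟩ = ⟨(T′δ_x w)(x′), v⟩` for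
`⟨f, Tg⟩ = ⟨T′f, g⟩` in the scalar product (I.1.5). [cite: Balaban1982Higgs1, (1.5) p.604, (2.20) p.610] [cite: Balaban1983Higgs3, (1.16) p.414] -/
theorem inner_vblk_comm (hadj : ∀ f g : ScalarField P 0 N, siteInner f (T g) = siteInner (T' f) g)
    (x x' : HiggsLattice.Site P 0) (v w : E N) :
    ⟪w, T (Pi.single x' v) x⟫_ℝ = ⟪T' (Pi.single x w) x', v⟫_ℝ := by
  have h := hadj (Pi.single x w) (Pi.single x' v)
  rw [HiggsFluctMeasurePos.siteInner_comm (Pi.single x w : ScalarField P 0 N), siteInner_single_right, siteInner_single_right,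
    real_inner_comm] at h
  have hm : (0 : ℝ) < P.mesh 0 ^ P.d := pow_pos (P.mesh_pos 0) _
  exact mul_left_cancel₀ hm.ne' h

/-- Hence `T(x,y)^* = T′(y,x)` for the blocks: THE COLUMN READING of the two-variable field `F(x,y) = T(x,y)` (from the second variable) IS THE
ROW READING of the adjoint's kernel. [cite: Balaban1982Higgs1, (2.20) p.610] [cite: Balaban1983Higgs3, (1.16) p.414, (1.32) p.420] -/
theorem star_vblk (hadj : ∀ f g : ScalarField P 0 N, siteInner f (T g) = siteInner (T' f) g) (x y : HiggsLattice.Site P 0) :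
    star (vblk T x y) = vblk T' y x := by
  rw [ContinuousLinearMap.star_eq_adjoint]
  refine ContinuousLinearMap.ext fun v => ?_
  refine ext_inner_right ℝ fun w => ?_
  rw [ContinuousLinearMap.adjoint_inner_left, vblk_apply, vblk_apply]
  exact inner_vblk_comm hadj x y w v

/-- **The adjoint identity of the row-differentiated block**: `⟨w, (D^ε_ATδ_{x′}v)(b)⟩ = ε^{−1}⟨(T′dip_b w)(x′), v⟩` — the COLUMN SLICE of the
row-differentiated kernel of `T`, as a field of `x′`, is `ε^{−1}T′(dip_b w)` (p40's dipole identity + adjointness).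
[cite: Balaban1982Higgs1, (1.7) p.605, (2.20) p.610] -/
theorem inner_dblk_single (hadj : ∀ f g : ScalarField P 0 N, siteInner f (T g) = siteInner (T' f) g)
    (b : HiggsLattice.PBond P 0) (x' : HiggsLattice.Site P 0) (v w : E N) :
    ⟪w, covDeriv C A (T (Pi.single x' v)) b⟫_ℝ = (P.mesh 0)⁻¹ * ⟪T' (dip C A b w) x', v⟫_ℝ := by
  have hε : P.mesh 0 ≠ 0 := (P.mesh_pos 0).ne'
  have hm : (0 : ℝ) < P.mesh 0 ^ P.d := pow_pos (P.mesh_pos 0) _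
  have h1 := siteInner_dip (C := C) (A := A) b w (T (Pi.single x' v))
  rw [hadj, siteInner_single_right] at h1
  have h2 := mul_left_cancel₀ hm.ne' h1
  rw [h2, ← mul_assoc, inv_mul_cancel₀ hε, one_mul]

/-- **The column move of VALUES**: for a chain `Γ′` from `y₁` inside a set `S_y` on whose bonds `‖(DT′)(b′, x)‖ ≤ M′` for the fixed row site `x`,
`‖T(x,end Γ′)∘U(A(Γ′))^* − T(x,y₁)‖ ≤ ε|Γ′|M′` — adjointness turns it into the row move of the field `T′δ_x w`.
[cite: Balaban1983Higgs3, (1.32) p.420] [cite: Balaban1982Higgs1, (2.20) p.610] -/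
theorem norm_vblk_comp_star_sub_le (hadj : ∀ f g : ScalarField P 0 N, siteInner f (T g) = siteInner (T' f) g)
    (hS : ∀ μ, 2 < P.sitesPerDir 0 μ) (x : HiggsLattice.Site P 0)
    (Sy : Finset (HiggsLattice.Site P 0)) {Mx : ℝ} (hMx : 0 ≤ Mx)
    (hD : ∀ (b : HiggsLattice.PBond P 0), b.src ∈ Sy → b.tgt ∈ Sy → ‖dblk C A T' b x‖ ≤ Mx)
    {y₁ : HiggsLattice.Site P 0} {Γ' : List (HiggsLattice.Site P 0)} (hch : IsTChain y₁ Γ') (hΓ : ∀ z ∈ y₁ :: Γ', z ∈ Sy) :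
    ‖(vblk T x (pathEnd y₁ Γ')).comp (star (hol C A y₁ Γ')) - vblk T x y₁‖ ≤ P.mesh 0 * Γ'.length * Mx := by
  have hε : 0 < P.mesh 0 := P.mesh_pos 0
  refine opNorm_le_of_inner_le _ (by positivity) fun v w => ?_
  set ψ : ScalarField P 0 N := T' (Pi.single x w) with hψ
  have hform : ⟪w, ((vblk T x (pathEnd y₁ Γ')).comp (star (hol C A y₁ Γ')) - vblk T x y₁) v⟫_ℝ
      = ⟪hol C A y₁ Γ' (ψ (pathEnd y₁ Γ')) - ψ y₁, v⟫_ℝ := by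
    rw [_root_.sub_apply, ContinuousLinearMap.comp_apply, inner_sub_right, vblk_apply, vblk_apply,
      inner_vblk_comm hadj, inner_vblk_comm hadj, ContinuousLinearMap.star_eq_adjoint,
      ContinuousLinearMap.adjoint_inner_right, inner_sub_left]
  rw [hform]
  have hpath := norm_hol_apply_sub_le hS C A ψ Sy (G := Mx * ‖w‖)
    (fun z μ hz hzμ => by
      rw [hψ, ← dblk_apply]
      exact (ContinuousLinearMap.le_opNorm _ _).trans (mul_le_mul_of_nonneg_right (hD ⟨z, μ⟩ hz hzμ) (norm_nonneg _)))
    hch hΓ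
  calc |⟪hol C A y₁ Γ' (ψ (pathEnd y₁ Γ')) - ψ y₁, v⟫_ℝ|
      ≤ ‖hol C A y₁ Γ' (ψ (pathEnd y₁ Γ')) - ψ y₁‖ * ‖v‖ := abs_real_inner_le_norm _ _
    _ ≤ P.mesh 0 * Γ'.length * (Mx * ‖w‖) * ‖v‖ := mul_le_mul_of_nonneg_right hpath (norm_nonneg _)
    _ = _ := by ring

/-- **The column move of the ROW-DIFFERENTIATED blocks** (the path lemma on the column field `ε^{−1}T′(dip_b w)`): for a chain `Γ′` from `y₁` to
`y₂` inside a set `S_y` on whose bonds `‖(D^ε_AT′ dip_b w)(c)‖ ≤ M_×‖w‖`, `‖(DT)(b,y₂)∘U(A(Γ′))^* − (DT)(b,y₁)‖ ≤ |Γ′|·M_×`.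
[cite: Balaban1983Higgs3, (1.32) p.420] [cite: Balaban1983RegularityDecay, p.578] -/
theorem norm_dblk_comp_star_sub_le (hadj : ∀ f g : ScalarField P 0 N, siteInner f (T g) = siteInner (T' f) g)
    (hS : ∀ μ, 2 < P.sitesPerDir 0 μ) (b : HiggsLattice.PBond P 0)
    (S : Finset (HiggsLattice.Site P 0)) {Mx : ℝ} (hMx : 0 ≤ Mx)
    (hD : ∀ (c : HiggsLattice.PBond P 0) (w : E N), c.src ∈ S → c.tgt ∈ S →
      ‖covDeriv C A (T' (dip C A b w)) c‖ ≤ Mx * ‖w‖)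
    {y₁ : HiggsLattice.Site P 0} {Γ' : List (HiggsLattice.Site P 0)} (hch : IsTChain y₁ Γ') (hΓ : ∀ z ∈ y₁ :: Γ', z ∈ S) :
    ‖(dblk C A T b (pathEnd y₁ Γ')).comp (star (hol C A y₁ Γ')) - dblk C A T b y₁‖ ≤ (Γ'.length : ℝ) * Mx := by
  have hε : 0 < P.mesh 0 := P.mesh_pos 0
  refine opNorm_le_of_inner_le _ (by positivity) fun v w => ?_
  set ψ : ScalarField P 0 N := T' (dip C A b w) with hψ
  have hform : ⟪w, ((dblk C A T b (pathEnd y₁ Γ')).comp (star (hol C A y₁ Γ')) - dblk C A T b y₁) v⟫_ℝ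
      = (P.mesh 0)⁻¹ * ⟪hol C A y₁ Γ' (ψ (pathEnd y₁ Γ')) - ψ y₁, v⟫_ℝ := by
    rw [_root_.sub_apply, ContinuousLinearMap.comp_apply, inner_sub_right, dblk_apply, dblk_apply,
      inner_dblk_single hadj, inner_dblk_single hadj, ContinuousLinearMap.star_eq_adjoint,
      ContinuousLinearMap.adjoint_inner_right, inner_sub_left, mul_sub]
  rw [hform, abs_mul, abs_of_nonneg (inv_nonneg.mpr hε.le)]
  have hpath := norm_hol_apply_sub_le hS C A ψ S (G := Mx * ‖w‖)
    (fun y μ hy hyμ => hD ⟨y, μ⟩ w hy hyμ) hch hΓ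
  have hin : |⟪hol C A y₁ Γ' (ψ (pathEnd y₁ Γ')) - ψ y₁, v⟫_ℝ| ≤ P.mesh 0 * Γ'.length * (Mx * ‖w‖) * ‖v‖ :=
    (abs_real_inner_le_norm _ _).trans (mul_le_mul_of_nonneg_right hpath (norm_nonneg _))
  calc (P.mesh 0)⁻¹ * |⟪hol C A y₁ Γ' (ψ (pathEnd y₁ Γ')) - ψ y₁, v⟫_ℝ|
      ≤ (P.mesh 0)⁻¹ * (P.mesh 0 * Γ'.length * (Mx * ‖w‖) * ‖v‖) := mul_le_mul_of_nonneg_left hin (inv_nonneg.mpr hε.le)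
    _ = (Γ'.length : ℝ) * Mx * ‖v‖ * ‖w‖ * ((P.mesh 0)⁻¹ * P.mesh 0) := by ring
    _ = (Γ'.length : ℝ) * Mx * ‖v‖ * ‖w‖ := by rw [inv_mul_cancel₀ hε.ne', mul_one]

end Blocks

/-! ## §2 The localized field of TWO block families, its derivatives by the product rule, its (1.32) norm, the multiplier -/

section Product

variable (C : ChargeData N) (A : HiggsLattice.VecField P 0) (k : ℕ)
  (KV : HiggsLattice.Site P 0 → HiggsLattice.Site P 0 → (E N →L[ℝ] E N))
  (KD : HiggsLattice.PBond P 0 → HiggsLattice.Site P 0 → (E N →L[ℝ] E N))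
  (KV' : HiggsLattice.Site P 0 → HiggsLattice.Site P 0 → (E N →L[ℝ] E N))
  (KD' : HiggsLattice.PBond P 0 → HiggsLattice.Site P 0 → (E N →L[ℝ] E N))

/-- **The covariant `η`-derivatives of `G = (h ⊗ h′)F` along the product bonds, BY THE PRODUCT RULE, two families**: on a ROW bond (differentiated
variable = the first) `a(c)·KD + b(c)·KV` with the row family, on a COLUMN bond (differentiated variable = the second) `a(c)·KD′ + b(c)·KV′` with the
column family — p40's coefficients `coefA`, `coefB`. [cite: Balaban1983Higgs3, (1.32) p.420] [cite: Balaban1982Higgs1, (1.7) p.605] -/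
def derivM2 (h h' : HiggsLattice.Site P 0 → ℝ) (c : PBd P) : E N →L[ℝ] E N :=
  coefA h h' c • (Sum.elim (fun _ => KD) (fun _ => KD') c) (hb c).1 (hb c).2
    + coefB k h h' c • (Sum.elim (fun _ => KV) (fun _ => KV') c) (hb c).1.src (hb c).2

/-- **The printed (1.32) norm of `(h ⊗ h′)F` on THE WHOLE PRODUCT LATTICE, two families**: `norm132` over all sites, all product bonds,
same-direction pairs at the sup-distance `pdist`, transports `U(A(Γ))∘·∘U(A(Γ′))^*` (`transp`); the values are read from the row family (p33's
`kerM`). [cite: Balaban1983Higgs3, (1.32) p.420] [cite: Balaban1983Higgs3, (2.5) p.424] -/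
def normM2 (α : ℝ) (h h' : HiggsLattice.Site P 0 → ℝ) : ℝ :=
  norm132 α (fun c c' : PBd P => dirOf c = dirOf c') (fun c c' => pdist k (baseOf c) (baseOf c')) (transp C A)
    Finset.univ Finset.univ (kerM KV h h') (derivM2 k KV KD KV' KD' h h')

variable {C A k KV KD KV' KD'}

/-- `normM2` unfolds to the printed sum form. [cite: Balaban1983Higgs3, (1.32) p.420] -/
theorem normM2_eq (α : ℝ) (h h' : HiggsLattice.Site P 0 → ℝ) :
    normM2 C A k KV KD KV' KD' α h h'
      = norm132 α (fun c c' : PBd P => dirOf c = dirOf c') (fun c c' => pdist k (baseOf c) (baseOf c')) (transp C A)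
          Finset.univ Finset.univ (kerM KV h h') (derivM2 k KV KD KV' KD' h h') :=
  rfl

/-- `derivM2` on a ROW bond `μ` over `(x,x′)`: `h′(x′)h(x+e_μ)·KD ⟨x,μ⟩ x′ + h′(x′)(∂^η_μh)(x)·KV x x′`. [cite: Balaban1983Higgs3, (1.32) p.420] -/
theorem derivM2_inl (h h' : HiggsLattice.Site P 0 → ℝ) (μ : Fin P.d) (x x' : HiggsLattice.Site P 0) :
    derivM2 k KV KD KV' KD' h h' (Sum.inl (μ, (x, x')))
      = (h' x' * h (x.shift μ)) • KD ⟨x, μ⟩ x' + (h' x' * dEta k h ⟨x, μ⟩) • KV x x' := by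
  simp only [derivM2, coefA, coefB, fd, fo, hb, Sum.elim_inl, HiggsLattice.PBond.tgt]

/-- `derivM2` on a COLUMN bond `ν` over `(x,x′)`: `h(x)h′(x′+e_ν)·KD′ ⟨x′,ν⟩ x + h(x)(∂^η_νh′)(x′)·KV′ x′ x` — the column family.
[cite: Balaban1983Higgs3, (1.32) p.420] -/
theorem derivM2_inr (h h' : HiggsLattice.Site P 0 → ℝ) (ν : Fin P.d) (x x' : HiggsLattice.Site P 0) :
    derivM2 k KV KD KV' KD' h h' (Sum.inr (ν, (x, x')))
      = (h x * h' (x'.shift ν)) • KD' ⟨x', ν⟩ x + (h x * dEta k h' ⟨x', ν⟩) • KV' x' x := by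
  simp only [derivM2, coefA, coefB, fd, fo, hb, Sum.elim_inr, HiggsLattice.PBond.tgt]

variable {m : ℕ}

/-- **`‖D^ηG(c)‖ ≤ (1 + c₁)·B` on every product bond** (row bonds by the row family on `(S,S′)`, column bonds by the column family on `(S′,S)`).
[cite: Balaban1983Higgs3, (2.5) p.424, (1.32) p.420] -/
theorem norm_derivM2_le {S S' : Finset (HiggsLattice.Site P 0)} {c₁ c₂ α : ℝ} (hc₁ : 0 ≤ c₁) {h h' : HiggsLattice.Site P 0 → ℝ}
    (hh : IsSmoothLoc k c₁ c₂ α S h) (hh' : IsSmoothLoc k c₁ c₂ α S' h') {BV : ℝ} (hBV : 0 ≤ BV)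
    (bY : ∀ x ∈ S, ∀ y ∈ S', ‖KV x y‖ ≤ BV) (bX : ∀ x ∈ S, ∀ y ∈ S', ∀ μ : Fin P.d, ‖KD ⟨x, μ⟩ y‖ ≤ BV)
    (bY' : ∀ x ∈ S', ∀ y ∈ S, ‖KV' x y‖ ≤ BV) (bX' : ∀ x ∈ S', ∀ y ∈ S, ∀ μ : Fin P.d, ‖KD' ⟨x, μ⟩ y‖ ≤ BV) (c : PBd P) :
    ‖derivM2 k KV KD KV' KD' h h' c‖ ≤ (1 + c₁) * BV := by
  rcases c with ⟨μ, x, x'⟩ | ⟨ν, x, x'⟩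
  · rw [derivM2_inl]
    exact norm_derivM_core hc₁ hh hh' hBV bY bX x x' μ
  · rw [derivM2_inr]
    exact norm_derivM_core hc₁ hh' hh hBV bY' bX' x' x ν

/-- **The Hölder quotients of `D^ηG` over same-direction product bonds at positive distance**, two families: p33/p40's core estimate
`holder_core_mulG` on `(S, S′)` with the row family for row pairs, on `(S′, S)` with the column family for column pairs.
[cite: Balaban1983Higgs3, (1.32) p.420] [cite: Balaban1983Higgs3, (2.5) p.424] -/
theorem holder_mulM2_le {S S' : Finset (HiggsLattice.Site P 0)}
    (hdiam : ∀ y₁ ∈ S, ∀ y₂ ∈ S, (HiggsLattice.Site.tdist y₁ y₂ : ℝ) / (P.L : ℝ) ^ k ≤ m)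
    (hdiam' : ∀ y₁ ∈ S', ∀ y₂ ∈ S', (HiggsLattice.Site.tdist y₁ y₂ : ℝ) / (P.L : ℝ) ^ k ≤ m)
    {c₁ c₂ α : ℝ} (hc₁ : 0 ≤ c₁) (hc₂ : 0 ≤ c₂) (hα0 : 0 ≤ α) (hα1 : α ≤ 1) {h h' : HiggsLattice.Site P 0 → ℝ}
    (hh : IsSmoothLoc k c₁ c₂ α S h) (hh' : IsSmoothLoc k c₁ c₂ α S' h') {BV BH : ℝ} (hBV : 0 ≤ BV) (hBH : 0 ≤ BH)
    (bY : ∀ x ∈ S, ∀ y ∈ S', ‖KV x y‖ ≤ BV)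
    (bX : ∀ x ∈ S, ∀ y ∈ S', ∀ μ : Fin P.d, ‖KD ⟨x, μ⟩ y‖ ≤ BV)
    (bH : ∀ (μ : Fin P.d) (x₁ x₂ y₁ y₂ : HiggsLattice.Site P 0), x₁ ∈ S → x₂ ∈ S → y₁ ∈ S' → y₂ ∈ S' →
      0 < max (HiggsLattice.Site.tdist x₁ x₂ : ℝ) (HiggsLattice.Site.tdist y₁ y₂ : ℝ) / (P.L : ℝ) ^ k →
      ‖(hol C A x₁ (cpath x₁ x₂)).comp ((KD ⟨x₂, μ⟩ y₂).comp (star (hol C A y₁ (cpath y₁ y₂)))) - KD ⟨x₁, μ⟩ y₁‖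
        ≤ BH * (max (HiggsLattice.Site.tdist x₁ x₂ : ℝ) (HiggsLattice.Site.tdist y₁ y₂ : ℝ) / (P.L : ℝ) ^ k) ^ α)
    (bM : ∀ (x₁ x₂ y₁ y₂ : HiggsLattice.Site P 0), x₁ ∈ S → x₂ ∈ S → y₁ ∈ S' → y₂ ∈ S' →
      ‖(hol C A x₁ (cpath x₁ x₂)).comp ((KV x₂ y₂).comp (star (hol C A y₁ (cpath y₁ y₂)))) - KV x₁ y₁‖
        ≤ (P.d : ℝ) * (((HiggsLattice.Site.tdist x₁ x₂ : ℝ) + (HiggsLattice.Site.tdist y₁ y₂ : ℝ)) / (P.L : ℝ) ^ k) * BV)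
    (bY' : ∀ x ∈ S', ∀ y ∈ S, ‖KV' x y‖ ≤ BV)
    (bX' : ∀ x ∈ S', ∀ y ∈ S, ∀ μ : Fin P.d, ‖KD' ⟨x, μ⟩ y‖ ≤ BV)
    (bH' : ∀ (μ : Fin P.d) (x₁ x₂ y₁ y₂ : HiggsLattice.Site P 0), x₁ ∈ S' → x₂ ∈ S' → y₁ ∈ S → y₂ ∈ S →
      0 < max (HiggsLattice.Site.tdist x₁ x₂ : ℝ) (HiggsLattice.Site.tdist y₁ y₂ : ℝ) / (P.L : ℝ) ^ k →
      ‖(hol C A x₁ (cpath x₁ x₂)).comp ((KD' ⟨x₂, μ⟩ y₂).comp (star (hol C A y₁ (cpath y₁ y₂)))) - KD' ⟨x₁, μ⟩ y₁‖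
        ≤ BH * (max (HiggsLattice.Site.tdist x₁ x₂ : ℝ) (HiggsLattice.Site.tdist y₁ y₂ : ℝ) / (P.L : ℝ) ^ k) ^ α)
    (bM' : ∀ (x₁ x₂ y₁ y₂ : HiggsLattice.Site P 0), x₁ ∈ S' → x₂ ∈ S' → y₁ ∈ S → y₂ ∈ S →
      ‖(hol C A x₁ (cpath x₁ x₂)).comp ((KV' x₂ y₂).comp (star (hol C A y₁ (cpath y₁ y₂)))) - KV' x₁ y₁‖
        ≤ (P.d : ℝ) * (((HiggsLattice.Site.tdist x₁ x₂ : ℝ) + (HiggsLattice.Site.tdist y₁ y₂ : ℝ)) / (P.L : ℝ) ^ k) * BV)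
    {c c' : PBd P} (hdir : dirOf c = dirOf c') (hpos : 0 < pdist k (baseOf c) (baseOf c')) :
    ‖transp C A c c' (derivM2 k KV KD KV' KD' h h' c') - derivM2 k KV KD KV' KD' h h' c‖
      ≤ (BH + ((2 * P.d * c₁ + 2) + 2 * P.d * m * c₁ + (c₂ + P.d * c₁ * c₁ + 2 * c₁)) * BV)
          * pdist k (baseOf c) (baseOf c') ^ α := by
  rcases c with ⟨μ, x₁, y₁⟩ | ⟨μ, y₁, x₁⟩ <;> rcases c' with ⟨μ', x₂, y₂⟩ | ⟨μ', y₂, x₂⟩ <;>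
    simp only [dirOf, Sum.elim_inl, Sum.elim_inr, Sum.inl.injEq, Sum.inr.injEq, reduceCtorEq] at hdir <;> subst hdir
  · rw [derivM2_inl, derivM2_inl]
    simp only [transp, hb, Sum.elim_inl, pdist, baseOf]
    exact holder_core_mulG hdiam hdiam' hc₁ hc₂ hα0 hα1 hh hh' hBV hBH bY bX bH bM μ hpos
  · rw [derivM2_inr, derivM2_inr]
    simp only [transp, hb, Sum.elim_inr, pdist, baseOf]
    change 0 < max (HiggsLattice.Site.tdist y₁ y₂ : ℝ) (HiggsLattice.Site.tdist x₁ x₂ : ℝ) / (P.L : ℝ) ^ k at hpos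
    rw [max_comm] at hpos
    have hres := holder_core_mulG hdiam' hdiam hc₁ hc₂ hα0 hα1 hh' hh hBV hBH bY' bX' bH' bM' μ hpos
    rw [max_comm]
    exact hres

/-- **`‖(h ⊗ h′)F‖_{1,α} ≤ K(c₁,c₂,d,m)·B + B_H` ON THE WHOLE PRODUCT LATTICE, TWO FAMILIES**, for smooth localization functions `h, h′` supported
(with collar) in two domains `S, S′` of diameter `≤ mL^k`, given the EIGHT block bounds — values and derivatives `≤ B`, transported Hölder differences
of the derivative blocks `≤ B_H·p^α`, transported value moves `≤ d(|Δx| + |Δy|)/L^k·B`, for the row family on `(S, S′)` and for the column family on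
`(S′, S)` —, `K = smoothConst d m c₁ c₂` (p33's `normM_le`, per branch). [cite: Balaban1983Higgs3, (1.32) p.420] [cite: Balaban1983Higgs3, p.420]
[cite: Balaban1983Higgs3, (2.5) p.424] -/
theorem normM2_le {S S' : Finset (HiggsLattice.Site P 0)}
    (hdiam : ∀ y₁ ∈ S, ∀ y₂ ∈ S, (HiggsLattice.Site.tdist y₁ y₂ : ℝ) / (P.L : ℝ) ^ k ≤ m)
    (hdiam' : ∀ y₁ ∈ S', ∀ y₂ ∈ S', (HiggsLattice.Site.tdist y₁ y₂ : ℝ) / (P.L : ℝ) ^ k ≤ m)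
    {c₁ c₂ α : ℝ} (hc₁ : 0 ≤ c₁) (hc₂ : 0 ≤ c₂) (hα0 : 0 ≤ α) (hα1 : α ≤ 1) {h h' : HiggsLattice.Site P 0 → ℝ}
    (hh : IsSmoothLoc k c₁ c₂ α S h) (hh' : IsSmoothLoc k c₁ c₂ α S' h') {BV BH : ℝ} (hBV : 0 ≤ BV) (hBH : 0 ≤ BH)
    (bY : ∀ x ∈ S, ∀ y ∈ S', ‖KV x y‖ ≤ BV)
    (bX : ∀ x ∈ S, ∀ y ∈ S', ∀ μ : Fin P.d, ‖KD ⟨x, μ⟩ y‖ ≤ BV)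
    (bH : ∀ (μ : Fin P.d) (x₁ x₂ y₁ y₂ : HiggsLattice.Site P 0), x₁ ∈ S → x₂ ∈ S → y₁ ∈ S' → y₂ ∈ S' →
      0 < max (HiggsLattice.Site.tdist x₁ x₂ : ℝ) (HiggsLattice.Site.tdist y₁ y₂ : ℝ) / (P.L : ℝ) ^ k →
      ‖(hol C A x₁ (cpath x₁ x₂)).comp ((KD ⟨x₂, μ⟩ y₂).comp (star (hol C A y₁ (cpath y₁ y₂)))) - KD ⟨x₁, μ⟩ y₁‖
        ≤ BH * (max (HiggsLattice.Site.tdist x₁ x₂ : ℝ) (HiggsLattice.Site.tdist y₁ y₂ : ℝ) / (P.L : ℝ) ^ k) ^ α)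
    (bM : ∀ (x₁ x₂ y₁ y₂ : HiggsLattice.Site P 0), x₁ ∈ S → x₂ ∈ S → y₁ ∈ S' → y₂ ∈ S' →
      ‖(hol C A x₁ (cpath x₁ x₂)).comp ((KV x₂ y₂).comp (star (hol C A y₁ (cpath y₁ y₂)))) - KV x₁ y₁‖
        ≤ (P.d : ℝ) * (((HiggsLattice.Site.tdist x₁ x₂ : ℝ) + (HiggsLattice.Site.tdist y₁ y₂ : ℝ)) / (P.L : ℝ) ^ k) * BV)
    (bY' : ∀ x ∈ S', ∀ y ∈ S, ‖KV' x y‖ ≤ BV)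
    (bX' : ∀ x ∈ S', ∀ y ∈ S, ∀ μ : Fin P.d, ‖KD' ⟨x, μ⟩ y‖ ≤ BV)
    (bH' : ∀ (μ : Fin P.d) (x₁ x₂ y₁ y₂ : HiggsLattice.Site P 0), x₁ ∈ S' → x₂ ∈ S' → y₁ ∈ S → y₂ ∈ S →
      0 < max (HiggsLattice.Site.tdist x₁ x₂ : ℝ) (HiggsLattice.Site.tdist y₁ y₂ : ℝ) / (P.L : ℝ) ^ k →
      ‖(hol C A x₁ (cpath x₁ x₂)).comp ((KD' ⟨x₂, μ⟩ y₂).comp (star (hol C A y₁ (cpath y₁ y₂)))) - KD' ⟨x₁, μ⟩ y₁‖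
        ≤ BH * (max (HiggsLattice.Site.tdist x₁ x₂ : ℝ) (HiggsLattice.Site.tdist y₁ y₂ : ℝ) / (P.L : ℝ) ^ k) ^ α)
    (bM' : ∀ (x₁ x₂ y₁ y₂ : HiggsLattice.Site P 0), x₁ ∈ S' → x₂ ∈ S' → y₁ ∈ S → y₂ ∈ S →
      ‖(hol C A x₁ (cpath x₁ x₂)).comp ((KV' x₂ y₂).comp (star (hol C A y₁ (cpath y₁ y₂)))) - KV' x₁ y₁‖
        ≤ (P.d : ℝ) * (((HiggsLattice.Site.tdist x₁ x₂ : ℝ) + (HiggsLattice.Site.tdist y₁ y₂ : ℝ)) / (P.L : ℝ) ^ k) * BV) :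
    normM2 C A k KV KD KV' KD' α h h' ≤ smoothConst P.d m c₁ c₂ * BV + BH := by
  have h1 : LatticeNorms.supNorm Finset.univ (kerM KV h h') ≤ BV := supNorm_le hBV fun z _ => norm_kerM_le hh hh' hBV bY z
  have h2 : LatticeNorms.supNorm Finset.univ (derivM2 k KV KD KV' KD' h h') ≤ (1 + c₁) * BV :=
    supNorm_le (by positivity) fun c _ => norm_derivM2_le hc₁ hh hh' hBV bY bX bY' bX' c
  have h3 : LatticeNorms.holderSeminorm α (fun c c' : PBd P => dirOf c = dirOf c') (fun c c' => pdist k (baseOf c) (baseOf c'))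
      (transp C A) Finset.univ (derivM2 k KV KD KV' KD' h h')
      ≤ BH + ((2 * P.d * c₁ + 2) + 2 * P.d * m * c₁ + (c₂ + P.d * c₁ * c₁ + 2 * c₁)) * BV :=
    holderSeminorm_le (by positivity) fun c _ c' _ hdir hpos =>
      holder_mulM2_le hdiam hdiam' hc₁ hc₂ hα0 hα1 hh hh' hBV hBH bY bX bH bM bY' bX' bH' bM' hdir hpos
  rw [normM2, norm132]
  calc _ ≤ BV + (1 + c₁) * BV + (BH + ((2 * P.d * c₁ + 2) + 2 * P.d * m * c₁ + (c₂ + P.d * c₁ * c₁ + 2 * c₁)) * BV) :=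
        add_le_add (add_le_add h1 h2) h3
    _ = _ := by unfold smoothConst; ring

end Product

/-! ## §3 The blocks in the print's `η`-units, admissible domains, and the eight block bounds from the kernel entries of `T` and `T′` -/

section Entries

variable (k : ℕ) (C : ChargeData N) (A : HiggsLattice.VecField P 0) (T : Module.End ℝ (ScalarField P 0 N))

/-- **The value blocks in the print's `η`-units**: `kv T x y = (L^kε)^{d−2}ε^{−d}·T(x,y)` (p40 g68's `unitV`; the units of a propagator kernel, which
the operator (1.16) has). [cite: Balaban1983Higgs3, (1.16) p.414, (2.5) p.424] -/
def kv (x y : HiggsLattice.Site P 0) : E N →L[ℝ] E N := unitV P k • vblk T x y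

/-- **The row-differentiated blocks in the print's `η`-units**: `kd T b y = (L^kε)^{d−1}ε^{−d}·(D^ε_AT)(b,y)` (one `η`-derivative `D^η = (L^kε)D^ε`
more). [cite: Balaban1983Higgs3, (1.32) p.420] [cite: Balaban1982Higgs1, (1.7) p.605] -/
def kd (b : HiggsLattice.PBond P 0) (y : HiggsLattice.Site P 0) : E N →L[ℝ] E N := unitD P k • dblk C A T b y

variable {k C A T} {T' : Module.End ℝ (ScalarField P 0 N)}

/-- `kv T x y^* = kv T′ y x` for an adjoint pair. [cite: Balaban1982Higgs1, (2.20) p.610] [cite: Balaban1983Higgs3, (1.32) p.420] -/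
theorem star_kv (hadj : ∀ f g : ScalarField P 0 N, siteInner f (T g) = siteInner (T' f) g) (x y : HiggsLattice.Site P 0) :
    star (kv k T x y) = kv k T' y x := by
  unfold kv; rw [star_smul, star_trivial, star_vblk hadj]

/-- adjointness is symmetric in the pair. [cite: Balaban1982Higgs1, (1.5) p.604] -/
theorem adj_symm (hadj : ∀ f g : ScalarField P 0 N, siteInner f (T g) = siteInner (T' f) g) (f g : ScalarField P 0 N) :
    siteInner f (T' g) = siteInner (T f) g := by
  rw [HiggsFluctMeasurePos.siteInner_comm f, ← hadj g f, HiggsFluctMeasurePos.siteInner_comm g]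

/-- **An admissible localization domain at scale `k` relative to a set of «good» points** (the points where the kernel entries are available —
interior points of a region in the instances): made of good points, closed under the coordinatewise contours `cpath` between its points, of diameter
`≤ mL^k` (p33's `DomD` forgetting the margin). [cite: Balaban1983Higgs3, (2.5) p.424, p.420] -/
structure DomG (k : ℕ) (Good : HiggsLattice.Site P 0 → Prop) (m : ℕ) (S : Finset (HiggsLattice.Site P 0)) : Prop where
  good : ∀ x ∈ S, Good x
  path : ∀ y₁ ∈ S, ∀ y₂ ∈ S, ∀ z ∈ y₁ :: cpath y₁ y₂, z ∈ S
  diam : ∀ y₁ ∈ S, ∀ y₂ ∈ S, (HiggsLattice.Site.tdist y₁ y₂ : ℝ) / (P.L : ℝ) ^ k ≤ m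

/-- p33's admissible domains are admissible for the interior points of `Ω₂`. [cite: Balaban1983Higgs3, (2.5) p.424] -/
theorem DomG.of_domD {K₀ r₀ m : ℕ} {Ω₂ S : Finset (HiggsLattice.Site P 0)} (h : DomD k K₀ Ω₂ r₀ m S) :
    DomG k (B3Ineq210RegularRegion.Interior k K₀ Ω₂) m S :=
  ⟨h.interior, h.path, h.diam⟩

/-- admissibility is monotone in the set of good points. [cite: Balaban1983Higgs3, (2.5) p.424] -/
theorem DomG.mono {Good Good' : HiggsLattice.Site P 0 → Prop} {m : ℕ} {S : Finset (HiggsLattice.Site P 0)} (h : DomG k Good m S)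
    (hG : ∀ x, Good x → Good' x) : DomG k Good' m S :=
  ⟨fun x hx => hG x (h.good x hx), h.path, h.diam⟩

variable {m : ℕ} {Good : HiggsLattice.Site P 0 → Prop} {Sb Sy : Finset (HiggsLattice.Site P 0)} {D : ℝ}

/-- kernel: a separation `L^kD ≤ |x − x′|` gives the decay factor `e^{−δ|x−x′|/L^k} ≤ e^{−δD}`. [cite: Balaban1983Higgs3, (2.5) p.424] -/
private theorem exp_sep_le {x x' : HiggsLattice.Site P 0} {δ : ℝ} (hδ : 0 ≤ δ)
    (h : (P.L : ℝ) ^ k * D ≤ (HiggsLattice.Site.tdist x x' : ℝ)) :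
    Real.exp (-(δ * ((HiggsLattice.Site.tdist x x' : ℝ) / (P.L : ℝ) ^ k))) ≤ Real.exp (-(δ * D)) := by
  have hLk : (0 : ℝ) < (P.L : ℝ) ^ k := pow_pos (by exact_mod_cast (lt_of_lt_of_le zero_lt_one P.hL)) k
  refine exp_dist_mono hδ ?_
  rw [le_div_iff₀ hLk, mul_comm]; exact h

/-- **Part 1 — the value blocks on `S_b × S_y`**: `‖kv T x y‖ ≤ C_V·e^{−δD}` for `x ∈ S_b`, `y ∈ S_y` at lattice distance `≥ DL^k`, from the value
entry of `T` at good points. [cite: Balaban1983Higgs3, (2.5) p.424, (1.16) p.414] -/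
theorem sup_partG {δ CV : ℝ} (hδ : 0 ≤ δ) (hCV : 0 ≤ CV)
    (hV : ∀ (x x' : HiggsLattice.Site P 0), Good x → Good x' →
      (P.mesh 0 ^ P.d)⁻¹ * ∑ i' : Ix N, ‖T (cb P N 0 (x', i')) x‖
        ≤ CV * (P.mesh k ^ 2 * (P.mesh k ^ P.d)⁻¹) * Real.exp (-(δ * ((HiggsLattice.Site.tdist x x' : ℝ) / (P.L : ℝ) ^ k))))
    (hdom : DomG k Good m Sb) (hdom' : DomG k Good m Sy)
    (hsep : ∀ x ∈ Sb, ∀ x' ∈ Sy, (P.L : ℝ) ^ k * D ≤ (HiggsLattice.Site.tdist x x' : ℝ))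
    {x y : HiggsLattice.Site P 0} (hx : x ∈ Sb) (hy : y ∈ Sy) :
    ‖kv k T x y‖ ≤ CV * Real.exp (-(δ * D)) := by
  have hmk := P.mesh_pos k
  have hU : 0 ≤ P.mesh k ^ P.d * (P.mesh k ^ 2)⁻¹ := by positivity
  have hid : P.mesh k ^ P.d * (P.mesh k ^ 2)⁻¹ * (P.mesh k ^ 2 * (P.mesh k ^ P.d)⁻¹) = 1 := by field_simp
  have hE1 := exp_sep_le (k := k) hδ (hsep x hx y hy)
  rw [kv, norm_smul, Real.norm_eq_abs, abs_of_pos (unitV_pos P k)]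
  calc unitV P k * ‖vblk T x y‖
      ≤ unitV P k * ∑ i' : Ix N, ‖T (cb P N 0 (y, i')) x‖ :=
        mul_le_mul_of_nonneg_left (norm_vblk_le x y) (unitV_pos P k).le
    _ = P.mesh k ^ P.d * (P.mesh k ^ 2)⁻¹ * ((P.mesh 0 ^ P.d)⁻¹ * ∑ i' : Ix N, ‖T (cb P N 0 (y, i')) x‖) := by
        rw [unitV]; ring
    _ ≤ P.mesh k ^ P.d * (P.mesh k ^ 2)⁻¹ * (CV * (P.mesh k ^ 2 * (P.mesh k ^ P.d)⁻¹) * Real.exp (-(δ * D))) :=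
        mul_le_mul_of_nonneg_left ((hV x y (hdom.good x hx) (hdom'.good y hy)).trans
          (mul_le_mul_of_nonneg_left hE1 (by positivity))) hU
    _ = CV * Real.exp (-(δ * D)) * (P.mesh k ^ P.d * (P.mesh k ^ 2)⁻¹ * (P.mesh k ^ 2 * (P.mesh k ^ P.d)⁻¹)) := by ring
    _ = _ := by rw [hid, mul_one]

/-- **The raw derivative bound on a domain pair**: for a `T_ε`-bond with source in `S_b` and the other site in `S_y`,
`(L^kε)^{d−1}ε^{−d}‖(D^ε_AT)(b, y)‖ ≤ C_D·e^{−δD}` (the target of `b` need not lie in `S_b`). [cite: Balaban1983Higgs3, (2.5) p.424, (1.32) p.420] -/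
theorem deriv_rawG {δ CD : ℝ} (hδ : 0 ≤ δ) (hCD : 0 ≤ CD)
    (hDv : ∀ (μ : Fin P.d) (x x' : HiggsLattice.Site P 0), Good x → Good x' →
      (P.mesh 0 ^ P.d)⁻¹ * ∑ i' : Ix N, ‖covDeriv C A (T (cb P N 0 (x', i'))) ⟨x, μ⟩‖
        ≤ CD * (P.mesh k * (P.mesh k ^ P.d)⁻¹) * Real.exp (-(δ * ((HiggsLattice.Site.tdist x x' : ℝ) / (P.L : ℝ) ^ k))))
    (hdom : DomG k Good m Sb) (hdom' : DomG k Good m Sy)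
    (hsep : ∀ x ∈ Sb, ∀ x' ∈ Sy, (P.L : ℝ) ^ k * D ≤ (HiggsLattice.Site.tdist x x' : ℝ))
    {x y : HiggsLattice.Site P 0} (hx : x ∈ Sb) (hy : y ∈ Sy) (μ : Fin P.d) :
    unitD P k * ‖dblk C A T ⟨x, μ⟩ y‖ ≤ CD * Real.exp (-(δ * D)) := by
  have hmk := P.mesh_pos k
  have hU : 0 ≤ P.mesh k ^ P.d * (P.mesh k)⁻¹ := by positivity
  have hid : P.mesh k ^ P.d * (P.mesh k)⁻¹ * (P.mesh k * (P.mesh k ^ P.d)⁻¹) = 1 := by field_simp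
  have hE1 := exp_sep_le (k := k) hδ (hsep x hx y hy)
  calc unitD P k * ‖dblk C A T ⟨x, μ⟩ y‖
      ≤ unitD P k * ∑ i' : Ix N, ‖covDeriv C A (T (cb P N 0 (y, i'))) ⟨x, μ⟩‖ :=
        mul_le_mul_of_nonneg_left (norm_dblk_le _ y) (unitD_pos P k).le
    _ = P.mesh k ^ P.d * (P.mesh k)⁻¹ *
          ((P.mesh 0 ^ P.d)⁻¹ * ∑ i' : Ix N, ‖covDeriv C A (T (cb P N 0 (y, i'))) ⟨x, μ⟩‖) := by
        rw [unitD]; ring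
    _ ≤ P.mesh k ^ P.d * (P.mesh k)⁻¹ * (CD * (P.mesh k * (P.mesh k ^ P.d)⁻¹) * Real.exp (-(δ * D))) :=
        mul_le_mul_of_nonneg_left ((hDv μ x y (hdom.good x hx) (hdom'.good y hy)).trans
          (mul_le_mul_of_nonneg_left hE1 (by positivity))) hU
    _ = CD * Real.exp (-(δ * D)) * (P.mesh k ^ P.d * (P.mesh k)⁻¹ * (P.mesh k * (P.mesh k ^ P.d)⁻¹)) := by ring
    _ = _ := by rw [hid, mul_one]

/-- **Part 2 — the derivative blocks**: `‖kd T ⟨x,μ⟩ y‖ ≤ C_D·e^{−δD}` for `x ∈ S_b`, `y ∈ S_y`. [cite: Balaban1983Higgs3, (2.5) p.424, (1.32) p.420] -/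
theorem deriv_partG {δ CD : ℝ} (hδ : 0 ≤ δ) (hCD : 0 ≤ CD)
    (hDv : ∀ (μ : Fin P.d) (x x' : HiggsLattice.Site P 0), Good x → Good x' →
      (P.mesh 0 ^ P.d)⁻¹ * ∑ i' : Ix N, ‖covDeriv C A (T (cb P N 0 (x', i'))) ⟨x, μ⟩‖
        ≤ CD * (P.mesh k * (P.mesh k ^ P.d)⁻¹) * Real.exp (-(δ * ((HiggsLattice.Site.tdist x x' : ℝ) / (P.L : ℝ) ^ k))))
    (hdom : DomG k Good m Sb) (hdom' : DomG k Good m Sy)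
    (hsep : ∀ x ∈ Sb, ∀ x' ∈ Sy, (P.L : ℝ) ^ k * D ≤ (HiggsLattice.Site.tdist x x' : ℝ))
    {x y : HiggsLattice.Site P 0} (hx : x ∈ Sb) (hy : y ∈ Sy) (μ : Fin P.d) :
    ‖kd k C A T ⟨x, μ⟩ y‖ ≤ CD * Real.exp (-(δ * D)) := by
  rw [kd, norm_smul, Real.norm_eq_abs, abs_of_pos (unitD_pos P k)]
  exact deriv_rawG hδ hCD hDv hdom hdom' hsep hx hy μ

/-- **Part 3a — the column move** `(DT)(b,y₂)∘U(A(Γ_{y₁,y₂}))^* − (DT)(b,y₁)` for `b` with source in `S_b`, `y₁, y₂ ∈ S_y`: bounded by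
`d|y₁−y₂|·M_×`, `M_× = ε^dε·C_M(L^kε)^{−d}e^{−δD}` the bound of the MIXED entry OF THE ADJOINT `T′` (dipole at `b`, derivative on the bonds of `S_y`; the
contour stays in `S_y`). [cite: Balaban1983Higgs3, (1.32) p.420, (2.5) p.424] -/
theorem termAG (hadj : ∀ f g : ScalarField P 0 N, siteInner f (T g) = siteInner (T' f) g)
    (hS : ∀ μ, 2 < P.sitesPerDir 0 μ) {δ CM : ℝ} (hδ : 0 ≤ δ) (hCM : 0 ≤ CM)
    (hM' : ∀ (μ ν : Fin P.d) (x x' : HiggsLattice.Site P 0), Good x → Good x' →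
      (P.mesh 0 ^ P.d)⁻¹ * ((P.mesh 0)⁻¹ *
          ∑ i : Ix N, ‖covDeriv C A (T' (dip C A ⟨x', ν⟩ (onb N i))) ⟨x, μ⟩‖)
        ≤ CM * (P.mesh k ^ P.d)⁻¹ * Real.exp (-(δ * ((HiggsLattice.Site.tdist x x' : ℝ) / (P.L : ℝ) ^ k))))
    (hdom : DomG k Good m Sb) (hdom' : DomG k Good m Sy)
    (hsep : ∀ x ∈ Sb, ∀ x' ∈ Sy, (P.L : ℝ) ^ k * D ≤ (HiggsLattice.Site.tdist x x' : ℝ))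
    {b : HiggsLattice.PBond P 0} (hbv : b.src ∈ Sb) {y₁ y₂ : HiggsLattice.Site P 0} (hy₁ : y₁ ∈ Sy) (hy₂ : y₂ ∈ Sy) :
    ‖(dblk C A T b y₂).comp (star (hol C A y₁ (cpath y₁ y₂))) - dblk C A T b y₁‖
      ≤ (P.d : ℝ) * (HiggsLattice.Site.tdist y₁ y₂ : ℝ) *
          (P.mesh 0 ^ P.d * P.mesh 0 * (CM * (P.mesh k ^ P.d)⁻¹ * Real.exp (-(δ * D)))) := by
  classical
  obtain ⟨xb, ν⟩ := b
  replace hbv : xb ∈ Sb := hbv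
  have hε : 0 ≤ P.mesh 0 ^ P.d * P.mesh 0 := by have := P.mesh_pos 0; positivity
  obtain ⟨Mx, hMx⟩ : ∃ Mx : ℝ, Mx = P.mesh 0 ^ P.d * P.mesh 0 * (CM * (P.mesh k ^ P.d)⁻¹ * Real.exp (-(δ * D))) := ⟨_, rfl⟩
  have hMx0 : 0 ≤ Mx := by rw [hMx]; have := P.mesh_pos k; positivity
  have hadm := isAdm_cpath y₁ y₂
  have hD : ∀ (c : HiggsLattice.PBond P 0) (w : E N), c.src ∈ Sy → c.tgt ∈ Sy →
      ‖covDeriv C A (T' (dip C A ⟨xb, ν⟩ w)) c‖ ≤ Mx * ‖w‖ := by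
    intro c w hc _
    obtain ⟨xc, μ⟩ := c
    replace hc : xc ∈ Sy := hc
    have hE1 : Real.exp (-(δ * ((HiggsLattice.Site.tdist xc xb : ℝ) / (P.L : ℝ) ^ k))) ≤ Real.exp (-(δ * D)) := by
      refine exp_sep_le (k := k) hδ ?_
      rw [tdist_comm]; exact hsep xb hbv xc hc
    have hsum : ∑ i : Ix N, ‖covDeriv C A (T' (dip C A ⟨xb, ν⟩ (onb N i))) ⟨xc, μ⟩‖
        = P.mesh 0 ^ P.d * P.mesh 0 * ((P.mesh 0 ^ P.d)⁻¹ * ((P.mesh 0)⁻¹ *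
          ∑ i : Ix N, ‖covDeriv C A (T' (dip C A ⟨xb, ν⟩ (onb N i))) ⟨xc, μ⟩‖)) := by
      have hε0 : P.mesh 0 ≠ 0 := (P.mesh_pos 0).ne'
      field_simp
    calc ‖covDeriv C A (T' (dip C A ⟨xb, ν⟩ w)) ⟨xc, μ⟩‖
        ≤ ‖w‖ * ∑ i : Ix N, ‖covDeriv C A (T' (dip C A ⟨xb, ν⟩ (onb N i))) ⟨xc, μ⟩‖ :=
          norm_covDeriv_dip_le_sum T' _ _ w
      _ ≤ ‖w‖ * Mx := by
          refine mul_le_mul_of_nonneg_left ?_ (norm_nonneg _)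
          rw [hsum, hMx]
          refine mul_le_mul_of_nonneg_left ((hM' μ ν xc xb (hdom'.good xc hc) (hdom.good xb hbv)).trans ?_) hε
          have := P.mesh_pos k
          exact mul_le_mul_of_nonneg_left hE1 (by positivity)
      _ = Mx * ‖w‖ := mul_comm _ _
  have h := norm_dblk_comp_star_sub_le (C := C) (A := A) hadj hS ⟨xb, ν⟩ Sy hMx0 hD hadm.1 (hdom'.path y₁ hy₁ y₂ hy₂)
  rw [pathEnd_cpath] at h
  rw [← hMx]
  exact h.trans (mul_le_mul_of_nonneg_right hadm.2.2 hMx0)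

/-- kernel: the Hölder weight identity `(ε|x₁−x₂|)^α·((L^kε)^α)^{−1} = (|x₁−x₂|/L^k)^α`. [cite: Balaban1983Higgs3, (2.11) p.426] -/
private theorem weight_top_eq (k : ℕ) {t α : ℝ} (ht : 0 ≤ t) :
    (P.mesh 0 * t) ^ α * (P.mesh k ^ α)⁻¹ = (t / (P.L : ℝ) ^ k) ^ α := by
  have hm0 : 0 < P.mesh 0 := P.mesh_pos 0
  have hmk : 0 < P.mesh k := P.mesh_pos k
  have e : t / (P.L : ℝ) ^ k = (P.mesh 0 * t) / P.mesh k := by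
    rw [mesh_eq_pow_mul P k]
    have hLk : (P.L : ℝ) ^ k ≠ 0 := (pow_pos (by exact_mod_cast P.hL) k).ne'
    field_simp
  rw [e, Real.div_rpow (by positivity) hmk.le, div_eq_mul_inv]

/-- **Part 3b — the row move** `U(A(Γ_{x₁,x₂}))(DT)(⟨x₂,μ⟩,y) − (DT)(⟨x₁,μ⟩,y)` in the print's units, `x₁, x₂ ∈ S_b`, `y ∈ S_y`: bounded by
`p^α·C_He^{−δD}` for any `p ≥ |x₁−x₂|/L^k`, from the Hölder entry of `T` along `Γ_{x₁,x₂} = cpath`. [cite: Balaban1983Higgs3, (1.32) p.420, (2.5) p.424] -/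
theorem termBG {α δ CH : ℝ} (hα0 : 0 ≤ α) (hδ : 0 ≤ δ) (hCH : 0 ≤ CH)
    (hH : ∀ (μ : Fin P.d) (x₁ x₂ x' : HiggsLattice.Site P 0) (Γ : List (HiggsLattice.Site P 0)),
      Good x₁ → Good x₂ → Good x' → x₁ ≠ x₂ → IsAdm x₁ x₂ Γ →
      (P.mesh 0 ^ P.d)⁻¹ * ∑ i' : Ix N, ‖hol C A x₁ Γ (covDeriv C A (T (cb P N 0 (x', i'))) ⟨x₂, μ⟩)
          - covDeriv C A (T (cb P N 0 (x', i'))) ⟨x₁, μ⟩‖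
        ≤ (P.mesh 0 * (HiggsLattice.Site.tdist x₁ x₂ : ℝ)) ^ α * (CH * (P.mesh k * (P.mesh k ^ P.d)⁻¹ * (P.mesh k ^ α)⁻¹)) *
          Real.exp (-(δ * (min (HiggsLattice.Site.tdist x₁ x' : ℝ) (HiggsLattice.Site.tdist x₂ x' : ℝ) / (P.L : ℝ) ^ k))))
    (hdom : DomG k Good m Sb) (hdom' : DomG k Good m Sy)
    (hsep : ∀ x ∈ Sb, ∀ x' ∈ Sy, (P.L : ℝ) ^ k * D ≤ (HiggsLattice.Site.tdist x x' : ℝ))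
    {x₁ x₂ y : HiggsLattice.Site P 0} (μ : Fin P.d) (hx₁ : x₁ ∈ Sb) (hx₂ : x₂ ∈ Sb) (hy : y ∈ Sy) {pd : ℝ}
    (hpd : (HiggsLattice.Site.tdist x₁ x₂ : ℝ) / (P.L : ℝ) ^ k ≤ pd) :
    unitD P k * ‖(hol C A x₁ (cpath x₁ x₂)).comp (dblk C A T ⟨x₂, μ⟩ y) - dblk C A T ⟨x₁, μ⟩ y‖
      ≤ pd ^ α * (CH * Real.exp (-(δ * D))) := by
  have hL0 : (0 : ℝ) < P.L := by exact_mod_cast (lt_of_lt_of_le zero_lt_one P.hL)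
  have hLk : (0 : ℝ) < (P.L : ℝ) ^ k := pow_pos hL0 k
  have hpd0 : 0 ≤ pd := le_trans (by positivity) hpd
  by_cases hx : x₁ = x₂
  · subst hx
    rw [cpath_self, hol_nil, ContinuousLinearMap.one_def, ContinuousLinearMap.id_comp, sub_self, norm_zero, mul_zero]
    positivity
  have hmk := P.mesh_pos k
  have hm0 := P.mesh_pos 0
  have hU : 0 ≤ P.mesh k ^ P.d * (P.mesh k)⁻¹ := by positivity
  have hE1 : Real.exp (-(δ * (min (HiggsLattice.Site.tdist x₁ y : ℝ) (HiggsLattice.Site.tdist x₂ y : ℝ) / (P.L : ℝ) ^ k)))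
      ≤ Real.exp (-(δ * D)) := by
    refine exp_dist_mono hδ ?_
    rw [le_div_iff₀ hLk, mul_comm]
    exact le_min (hsep x₁ hx₁ y hy) (hsep x₂ hx₂ y hy)
  have ht0 : 0 ≤ (HiggsLattice.Site.tdist x₁ x₂ : ℝ) := Nat.cast_nonneg _
  have hwt : (P.mesh 0 * (HiggsLattice.Site.tdist x₁ x₂ : ℝ)) ^ α * (P.mesh k ^ α)⁻¹ ≤ pd ^ α := by
    rw [weight_top_eq k ht0]
    exact Real.rpow_le_rpow (by positivity) hpd hα0
  have hid : P.mesh k ^ P.d * (P.mesh k)⁻¹ * (P.mesh k * (P.mesh k ^ P.d)⁻¹) = 1 := by field_simp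
  calc unitD P k * ‖(hol C A x₁ (cpath x₁ x₂)).comp (dblk C A T ⟨x₂, μ⟩ y) - dblk C A T ⟨x₁, μ⟩ y‖
      ≤ unitD P k * ∑ i' : Ix N, ‖hol C A x₁ (cpath x₁ x₂) (covDeriv C A (T (cb P N 0 (y, i'))) ⟨x₂, μ⟩)
          - covDeriv C A (T (cb P N 0 (y, i'))) ⟨x₁, μ⟩‖ :=
        mul_le_mul_of_nonneg_left (norm_hol_comp_dblk_sub_le x₁ x₂ y _ μ) (unitD_pos P k).le
    _ = P.mesh k ^ P.d * (P.mesh k)⁻¹ * ((P.mesh 0 ^ P.d)⁻¹ * ∑ i' : Ix N,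
          ‖hol C A x₁ (cpath x₁ x₂) (covDeriv C A (T (cb P N 0 (y, i'))) ⟨x₂, μ⟩)
            - covDeriv C A (T (cb P N 0 (y, i'))) ⟨x₁, μ⟩‖) := by rw [unitD]; ring
    _ ≤ P.mesh k ^ P.d * (P.mesh k)⁻¹ * ((P.mesh 0 * (HiggsLattice.Site.tdist x₁ x₂ : ℝ)) ^ α *
          (CH * (P.mesh k * (P.mesh k ^ P.d)⁻¹ * (P.mesh k ^ α)⁻¹)) * Real.exp (-(δ * D))) := by
        refine mul_le_mul_of_nonneg_left ((hH μ x₁ x₂ y _ (hdom.good x₁ hx₁) (hdom.good x₂ hx₂) (hdom'.good y hy) hx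
          (isAdm_cpath x₁ x₂)).trans ?_) hU
        have h0 : 0 ≤ (P.mesh 0 * (HiggsLattice.Site.tdist x₁ x₂ : ℝ)) ^ α * (CH * (P.mesh k * (P.mesh k ^ P.d)⁻¹ * (P.mesh k ^ α)⁻¹)) := by
          have : 0 ≤ (P.mesh 0 * (HiggsLattice.Site.tdist x₁ x₂ : ℝ)) ^ α := Real.rpow_nonneg (by positivity) _
          have : 0 < P.mesh k ^ α := Real.rpow_pos_of_pos hmk α
          positivity
        exact mul_le_mul_of_nonneg_left hE1 h0
    _ = ((P.mesh 0 * (HiggsLattice.Site.tdist x₁ x₂ : ℝ)) ^ α * (P.mesh k ^ α)⁻¹) * (CH * Real.exp (-(δ * D))) *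
          (P.mesh k ^ P.d * (P.mesh k)⁻¹ * (P.mesh k * (P.mesh k ^ P.d)⁻¹)) := by ring
    _ ≤ pd ^ α * (CH * Real.exp (-(δ * D))) := by
        rw [hid, mul_one]; exact mul_le_mul_of_nonneg_right hwt (by positivity)

/-- inside a domain of diameter `≤ m`: `p ≤ m·p^α` for `0 < p ≤ m`, `0 ≤ α ≤ 1`, `m ≥ 1`. [folklore] -/
private theorem le_mul_rpow_of_le {p α : ℝ} {m : ℕ} (hp : 0 < p) (hpm : p ≤ m) (hα0 : 0 ≤ α) (hα1 : α ≤ 1) : p ≤ m * p ^ α := by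
  have hm1 : (1 : ℝ) ≤ m := by
    have : (0 : ℝ) < m := hp.trans_le hpm
    exact_mod_cast Nat.one_le_iff_ne_zero.mpr (by rintro rfl; simp at this)
  have e : p = p ^ α * p ^ (1 - α) := by
    rw [← Real.rpow_add hp, add_sub_cancel, Real.rpow_one]
  have h1 : p ^ (1 - α) ≤ (m : ℝ) ^ (1 - α) := Real.rpow_le_rpow hp.le hpm (by linarith)
  have h2 : (m : ℝ) ^ (1 - α) ≤ (m : ℝ) ^ (1 : ℝ) := Real.rpow_le_rpow_of_exponent_le hm1 (by linarith)
  rw [Real.rpow_one] at h2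
  calc p = p ^ α * p ^ (1 - α) := e
    _ ≤ p ^ α * m := mul_le_mul_of_nonneg_left (h1.trans h2) (Real.rpow_nonneg hp.le _)
    _ = m * p ^ α := mul_comm _ _

/-- **Part 3 — the transported Hölder differences of the derivative blocks, one same-direction pair in explicit variables**: bonds `⟨x₁,μ⟩, ⟨x₂,μ⟩`
over `S_b`, other sites `y₁, y₂ ∈ S_y`: `‖U(A(Γ_{x₁,x₂}))kd T(⟨x₂,μ⟩,y₂)U(A(Γ_{y₁,y₂}))^* − kd T(⟨x₁,μ⟩,y₁)‖ ≤ (C_H + dmC_M)e^{−δD}·p^α`,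
`p = max(|x₁−x₂|,|y₁−y₂|)/L^k > 0` — triangle through `(⟨x₂,μ⟩,y₁)`: column move (Part 3a, the mixed entry of `T′`; `|y₁−y₂|/L^k ≤ p ≤ mp^α` inside a
domain of diameter `m`) plus row move (Part 3b, the Hölder entry of `T`). [cite: Balaban1983Higgs3, (2.5) p.424, (1.32) p.420] -/
theorem holder_coreG (hadj : ∀ f g : ScalarField P 0 N, siteInner f (T g) = siteInner (T' f) g)
    (hS : ∀ μ, 2 < P.sitesPerDir 0 μ) {α δ CH CM : ℝ} (hα0 : 0 ≤ α) (hα1 : α ≤ 1) (hδ : 0 ≤ δ)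
    (hCH : 0 ≤ CH) (hCM : 0 ≤ CM)
    (hH : ∀ (μ : Fin P.d) (x₁ x₂ x' : HiggsLattice.Site P 0) (Γ : List (HiggsLattice.Site P 0)),
      Good x₁ → Good x₂ → Good x' → x₁ ≠ x₂ → IsAdm x₁ x₂ Γ →
      (P.mesh 0 ^ P.d)⁻¹ * ∑ i' : Ix N, ‖hol C A x₁ Γ (covDeriv C A (T (cb P N 0 (x', i'))) ⟨x₂, μ⟩)
          - covDeriv C A (T (cb P N 0 (x', i'))) ⟨x₁, μ⟩‖
        ≤ (P.mesh 0 * (HiggsLattice.Site.tdist x₁ x₂ : ℝ)) ^ α * (CH * (P.mesh k * (P.mesh k ^ P.d)⁻¹ * (P.mesh k ^ α)⁻¹)) *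
          Real.exp (-(δ * (min (HiggsLattice.Site.tdist x₁ x' : ℝ) (HiggsLattice.Site.tdist x₂ x' : ℝ) / (P.L : ℝ) ^ k))))
    (hM' : ∀ (μ ν : Fin P.d) (x x' : HiggsLattice.Site P 0), Good x → Good x' →
      (P.mesh 0 ^ P.d)⁻¹ * ((P.mesh 0)⁻¹ *
          ∑ i : Ix N, ‖covDeriv C A (T' (dip C A ⟨x', ν⟩ (onb N i))) ⟨x, μ⟩‖)
        ≤ CM * (P.mesh k ^ P.d)⁻¹ * Real.exp (-(δ * ((HiggsLattice.Site.tdist x x' : ℝ) / (P.L : ℝ) ^ k))))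
    (hdom : DomG k Good m Sb) (hdom' : DomG k Good m Sy)
    (hsep : ∀ x ∈ Sb, ∀ x' ∈ Sy, (P.L : ℝ) ^ k * D ≤ (HiggsLattice.Site.tdist x x' : ℝ))
    {x₁ x₂ y₁ y₂ : HiggsLattice.Site P 0} (μ : Fin P.d) (hx₁ : x₁ ∈ Sb) (hx₂ : x₂ ∈ Sb) (hy₁ : y₁ ∈ Sy) (hy₂ : y₂ ∈ Sy)
    (hpos : 0 < max (HiggsLattice.Site.tdist x₁ x₂ : ℝ) (HiggsLattice.Site.tdist y₁ y₂ : ℝ) / (P.L : ℝ) ^ k) :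
    ‖(hol C A x₁ (cpath x₁ x₂)).comp ((kd k C A T ⟨x₂, μ⟩ y₂).comp (star (hol C A y₁ (cpath y₁ y₂))))
        - kd k C A T ⟨x₁, μ⟩ y₁‖
      ≤ (CH + P.d * m * CM) * Real.exp (-(δ * D)) *
          (max (HiggsLattice.Site.tdist x₁ x₂ : ℝ) (HiggsLattice.Site.tdist y₁ y₂ : ℝ) / (P.L : ℝ) ^ k) ^ α := by
  have hL0 : (0 : ℝ) < P.L := by exact_mod_cast (lt_of_lt_of_le zero_lt_one P.hL)
  have hLk : (0 : ℝ) < (P.L : ℝ) ^ k := pow_pos hL0 k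
  obtain ⟨pd, hpd⟩ : ∃ pd : ℝ,
      pd = max (HiggsLattice.Site.tdist x₁ x₂ : ℝ) (HiggsLattice.Site.tdist y₁ y₂ : ℝ) / (P.L : ℝ) ^ k := ⟨_, rfl⟩
  rw [← hpd] at hpos ⊢
  have htb : (HiggsLattice.Site.tdist x₁ x₂ : ℝ) / (P.L : ℝ) ^ k ≤ pd := by
    rw [hpd]; exact div_le_div_of_nonneg_right (le_max_left _ _) hLk.le
  have hty : (HiggsLattice.Site.tdist y₁ y₂ : ℝ) / (P.L : ℝ) ^ k ≤ pd := by
    rw [hpd]; exact div_le_div_of_nonneg_right (le_max_right _ _) hLk.le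
  have hpdm : pd ≤ m := by
    rw [hpd, ← max_div_div_right hLk.le]
    exact max_le (hdom.diam x₁ hx₁ x₂ hx₂) (hdom'.diam y₁ hy₁ y₂ hy₂)
  have hpdα : pd ≤ m * pd ^ α := le_mul_rpow_of_le hpos hpdm hα0 hα1
  unfold kd
  have e : (hol C A x₁ (cpath x₁ x₂)).comp
          ((unitD P k • dblk C A T ⟨x₂, μ⟩ y₂).comp (star (hol C A y₁ (cpath y₁ y₂))))
        - unitD P k • dblk C A T ⟨x₁, μ⟩ y₁
      = unitD P k • ((hol C A x₁ (cpath x₁ x₂)).comp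
          ((dblk C A T ⟨x₂, μ⟩ y₂).comp (star (hol C A y₁ (cpath y₁ y₂))) - dblk C A T ⟨x₂, μ⟩ y₁) +
        ((hol C A x₁ (cpath x₁ x₂)).comp (dblk C A T ⟨x₂, μ⟩ y₁) - dblk C A T ⟨x₁, μ⟩ y₁)) := by
    rw [ContinuousLinearMap.smul_comp, ContinuousLinearMap.comp_smul, ContinuousLinearMap.comp_sub, sub_add_sub_cancel,
      smul_sub]
  rw [e, norm_smul, Real.norm_eq_abs, abs_of_pos (unitD_pos P k)]
  have hA := termAG (C := C) (A := A) hadj hS hδ hCM hM' hdom hdom' hsep (b := ⟨x₂, μ⟩) hx₂ hy₁ hy₂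
  have hB := termBG (C := C) (A := A) (T := T) hα0 hδ hCH hH hdom hdom' hsep μ hx₁ hx₂ hy₁ htb
  have hu : unitD P k * (P.mesh 0 ^ P.d * P.mesh 0) * (P.mesh k ^ P.d)⁻¹ = ((P.L : ℝ) ^ k)⁻¹ := by
    unfold unitD
    rw [mesh_eq_pow_mul P k]
    have hε0 : P.mesh 0 ≠ 0 := (P.mesh_pos 0).ne'
    have hLk0 : (P.L : ℝ) ^ k ≠ 0 := hLk.ne'
    field_simp
  obtain ⟨TA, hTA⟩ : ∃ X : E N →L[ℝ] E N,
      (dblk C A T ⟨x₂, μ⟩ y₂).comp (star (hol C A y₁ (cpath y₁ y₂))) - dblk C A T ⟨x₂, μ⟩ y₁ = X := ⟨_, rfl⟩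
  obtain ⟨TB, hTB⟩ : ∃ X : E N →L[ℝ] E N,
      (hol C A x₁ (cpath x₁ x₂)).comp (dblk C A T ⟨x₂, μ⟩ y₁) - dblk C A T ⟨x₁, μ⟩ y₁ = X := ⟨_, rfl⟩
  rw [hTA] at hA ⊢
  rw [hTB] at hB ⊢
  have hu0 := (unitD_pos P k).le
  have hX : ‖(hol C A x₁ (cpath x₁ x₂)).comp TA‖ ≤ ‖TA‖ := norm_hol_comp_le _ _ _
  have hK0 : 0 ≤ CM * Real.exp (-(δ * D)) := by positivity
  calc unitD P k * ‖(hol C A x₁ (cpath x₁ x₂)).comp TA + TB‖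
      ≤ unitD P k * (‖TA‖ + ‖TB‖) := mul_le_mul_of_nonneg_left ((norm_add_le _ _).trans (add_le_add hX le_rfl)) hu0
    _ = unitD P k * ‖TA‖ + unitD P k * ‖TB‖ := mul_add _ _ _
    _ ≤ unitD P k * ((P.d : ℝ) * (HiggsLattice.Site.tdist y₁ y₂ : ℝ) * (P.mesh 0 ^ P.d * P.mesh 0 *
            (CM * (P.mesh k ^ P.d)⁻¹ * Real.exp (-(δ * D))))) +
          pd ^ α * (CH * Real.exp (-(δ * D))) :=
        add_le_add (mul_le_mul_of_nonneg_left hA hu0) hB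
    _ = (P.d : ℝ) * ((HiggsLattice.Site.tdist y₁ y₂ : ℝ) * (unitD P k * (P.mesh 0 ^ P.d * P.mesh 0) * (P.mesh k ^ P.d)⁻¹)) *
            (CM * Real.exp (-(δ * D))) +
          pd ^ α * (CH * Real.exp (-(δ * D))) := by ring
    _ = (P.d : ℝ) * ((HiggsLattice.Site.tdist y₁ y₂ : ℝ) / (P.L : ℝ) ^ k) * (CM * Real.exp (-(δ * D))) +
          pd ^ α * (CH * Real.exp (-(δ * D))) := by
        rw [hu]; ring
    _ ≤ (P.d : ℝ) * (m * pd ^ α) * (CM * Real.exp (-(δ * D))) + pd ^ α * (CH * Real.exp (-(δ * D))) :=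
        add_le_add (mul_le_mul_of_nonneg_right
          (mul_le_mul_of_nonneg_left (hty.trans hpdα) (Nat.cast_nonneg _)) hK0) le_rfl
    _ = _ := by ring

/-- **Part 4 — the value-Lipschitz clause on a domain pair, one same-direction pair in explicit variables**: `x₁, x₂ ∈ S_b`, `y₁, y₂ ∈ S_y`:
`‖U(A(Γ_{x₁,x₂}))kv T(x₂,y₂)U(A(Γ_{y₁,y₂}))^* − kv T(x₁,y₁)‖ ≤ d(|x₁−x₂| + |y₁−y₂|)/L^k · C_De^{−δD}` — column move inside `S_y` (the derivative entry
of `T′`, by adjointness) plus row move inside `S_b` (the derivative entry of `T`), each `η`-step one derivative (`unitV·ε = unitD/L^k`).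
[cite: Balaban1983Higgs3, (1.32) p.420, (2.5) p.424] -/
theorem value_moveG (hadj : ∀ f g : ScalarField P 0 N, siteInner f (T g) = siteInner (T' f) g)
    (hS : ∀ μ, 2 < P.sitesPerDir 0 μ) {δ CD : ℝ} (hδ : 0 ≤ δ) (hCD : 0 ≤ CD)
    (hDv : ∀ (μ : Fin P.d) (x x' : HiggsLattice.Site P 0), Good x → Good x' →
      (P.mesh 0 ^ P.d)⁻¹ * ∑ i' : Ix N, ‖covDeriv C A (T (cb P N 0 (x', i'))) ⟨x, μ⟩‖
        ≤ CD * (P.mesh k * (P.mesh k ^ P.d)⁻¹) * Real.exp (-(δ * ((HiggsLattice.Site.tdist x x' : ℝ) / (P.L : ℝ) ^ k))))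
    (hDv' : ∀ (μ : Fin P.d) (x x' : HiggsLattice.Site P 0), Good x → Good x' →
      (P.mesh 0 ^ P.d)⁻¹ * ∑ i' : Ix N, ‖covDeriv C A (T' (cb P N 0 (x', i'))) ⟨x, μ⟩‖
        ≤ CD * (P.mesh k * (P.mesh k ^ P.d)⁻¹) * Real.exp (-(δ * ((HiggsLattice.Site.tdist x x' : ℝ) / (P.L : ℝ) ^ k))))
    (hdom : DomG k Good m Sb) (hdom' : DomG k Good m Sy)
    (hsep : ∀ x ∈ Sb, ∀ x' ∈ Sy, (P.L : ℝ) ^ k * D ≤ (HiggsLattice.Site.tdist x x' : ℝ))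
    {x₁ x₂ y₁ y₂ : HiggsLattice.Site P 0} (hx₁ : x₁ ∈ Sb) (hx₂ : x₂ ∈ Sb) (hy₁ : y₁ ∈ Sy) (hy₂ : y₂ ∈ Sy) :
    ‖(hol C A x₁ (cpath x₁ x₂)).comp ((kv k T x₂ y₂).comp (star (hol C A y₁ (cpath y₁ y₂)))) - kv k T x₁ y₁‖
      ≤ (P.d : ℝ) * (((HiggsLattice.Site.tdist x₁ x₂ : ℝ) + (HiggsLattice.Site.tdist y₁ y₂ : ℝ)) / (P.L : ℝ) ^ k) *
          (CD * Real.exp (-(δ * D))) := by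
  have hL0 : (0 : ℝ) < P.L := by exact_mod_cast (lt_of_lt_of_le zero_lt_one P.hL)
  have hLk : (0 : ℝ) < (P.L : ℝ) ^ k := pow_pos hL0 k
  set B : ℝ := CD * Real.exp (-(δ * D)) with hB
  have hB0 : 0 ≤ B := by positivity
  have hsep' : ∀ x ∈ Sy, ∀ x' ∈ Sb, (P.L : ℝ) ^ k * D ≤ (HiggsLattice.Site.tdist x x' : ℝ) := by
    intro x hx x' hx'; rw [tdist_comm]; exact hsep x' hx' x hx
  have hMx0 : 0 ≤ B / unitD P k := div_nonneg hB0 (unitD_pos P k).le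
  have hrow : ∀ (b : HiggsLattice.PBond P 0), b.src ∈ Sb → b.tgt ∈ Sb → ‖dblk C A T b y₁‖ ≤ B / unitD P k := by
    intro b hb _
    obtain ⟨x, μ⟩ := b
    rw [le_div_iff₀ (unitD_pos P k), mul_comm]
    exact deriv_rawG hδ hCD hDv hdom hdom' hsep hb hy₁ μ
  have hcol : ∀ (b : HiggsLattice.PBond P 0), b.src ∈ Sy → b.tgt ∈ Sy → ‖dblk C A T' b x₂‖ ≤ B / unitD P k := by
    intro b hb _
    obtain ⟨y, μ⟩ := b
    rw [le_div_iff₀ (unitD_pos P k), mul_comm]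
    exact deriv_rawG hδ hCD hDv' hdom' hdom hsep' hb hx₂ μ
  have hadmx := isAdm_cpath x₁ x₂
  have hadmy := isAdm_cpath y₁ y₂
  have hA := norm_vblk_comp_star_sub_le (C := C) (A := A) hadj hS x₂ Sy hMx0 hcol hadmy.1 (hdom'.path y₁ hy₁ y₂ hy₂)
  have hBm := norm_hol_comp_vblk_sub_le (C := C) (A := A) (T := T) hS y₁ Sb hMx0 hrow hadmx.1 (hdom.path x₁ hx₁ x₂ hx₂)
  rw [pathEnd_cpath] at hA hBm
  unfold kv
  have e : (hol C A x₁ (cpath x₁ x₂)).comp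
          ((unitV P k • vblk T x₂ y₂).comp (star (hol C A y₁ (cpath y₁ y₂))))
        - unitV P k • vblk T x₁ y₁
      = unitV P k • ((hol C A x₁ (cpath x₁ x₂)).comp
          ((vblk T x₂ y₂).comp (star (hol C A y₁ (cpath y₁ y₂))) - vblk T x₂ y₁) +
        ((hol C A x₁ (cpath x₁ x₂)).comp (vblk T x₂ y₁) - vblk T x₁ y₁)) := by
    rw [ContinuousLinearMap.smul_comp, ContinuousLinearMap.comp_smul, ContinuousLinearMap.comp_sub, sub_add_sub_cancel,
      smul_sub]
  rw [e, norm_smul, Real.norm_eq_abs, abs_of_pos (unitV_pos P k)]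
  obtain ⟨TA, hTA⟩ : ∃ X : E N →L[ℝ] E N,
      (vblk T x₂ y₂).comp (star (hol C A y₁ (cpath y₁ y₂))) - vblk T x₂ y₁ = X := ⟨_, rfl⟩
  obtain ⟨TB, hTB⟩ : ∃ X : E N →L[ℝ] E N,
      (hol C A x₁ (cpath x₁ x₂)).comp (vblk T x₂ y₁) - vblk T x₁ y₁ = X := ⟨_, rfl⟩
  rw [hTA] at hA ⊢
  rw [hTB] at hBm ⊢
  have hX : ‖(hol C A x₁ (cpath x₁ x₂)).comp TA‖ ≤ ‖TA‖ := norm_hol_comp_le _ _ _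
  have hu : unitV P k * P.mesh 0 * (B / unitD P k) = ((P.L : ℝ) ^ k)⁻¹ * B := by
    rw [unitV_mul_mesh]
    have hD0 : unitD P k ≠ 0 := (unitD_pos P k).ne'
    field_simp
  calc unitV P k * ‖(hol C A x₁ (cpath x₁ x₂)).comp TA + TB‖
      ≤ unitV P k * (‖TA‖ + ‖TB‖) :=
        mul_le_mul_of_nonneg_left ((norm_add_le _ _).trans (add_le_add hX le_rfl)) (unitV_pos P k).le
    _ ≤ unitV P k * (P.mesh 0 * (cpath y₁ y₂).length * (B / unitD P k) + P.mesh 0 * (cpath x₁ x₂).length * (B / unitD P k)) :=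
        mul_le_mul_of_nonneg_left (add_le_add hA hBm) (unitV_pos P k).le
    _ = unitV P k * P.mesh 0 * (B / unitD P k) * ((cpath y₁ y₂).length + (cpath x₁ x₂).length) := by ring
    _ = ((P.L : ℝ) ^ k)⁻¹ * B * ((cpath y₁ y₂).length + (cpath x₁ x₂).length) := by rw [hu]
    _ ≤ ((P.L : ℝ) ^ k)⁻¹ * B *
          ((P.d : ℝ) * (HiggsLattice.Site.tdist y₁ y₂ : ℝ) + (P.d : ℝ) * (HiggsLattice.Site.tdist x₁ x₂ : ℝ)) :=
        mul_le_mul_of_nonneg_left (add_le_add hadmy.2.2 hadmx.2.2) (by positivity)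
    _ = _ := by rw [hB]; field_simp; ring

/-- **The four bounds of the ROW family `(kv T, kd T)` on a pair of admissible domains, packed** (Parts 1–4) with `B = (C_V + C_D)e^{−δD}`,
`B_H = (C_H + dmC_M)e^{−δD}`, in the hypothesis shapes of the multiplier `normM2_le` — from the value, derivative and Hölder entries of `T` and the
derivative and mixed entries of its adjoint `T′`. [cite: Balaban1983Higgs3, (2.5) p.424, (1.32) p.420] -/
theorem bounds_packG (hadj : ∀ f g : ScalarField P 0 N, siteInner f (T g) = siteInner (T' f) g)
    (hS : ∀ μ, 2 < P.sitesPerDir 0 μ) {α δ CV CD CH CM : ℝ} (hα0 : 0 ≤ α) (hα1 : α ≤ 1) (hδ : 0 ≤ δ)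
    (hCV : 0 ≤ CV) (hCD : 0 ≤ CD) (hCH : 0 ≤ CH) (hCM : 0 ≤ CM)
    (hV : ∀ (x x' : HiggsLattice.Site P 0), Good x → Good x' →
      (P.mesh 0 ^ P.d)⁻¹ * ∑ i' : Ix N, ‖T (cb P N 0 (x', i')) x‖
        ≤ CV * (P.mesh k ^ 2 * (P.mesh k ^ P.d)⁻¹) * Real.exp (-(δ * ((HiggsLattice.Site.tdist x x' : ℝ) / (P.L : ℝ) ^ k))))
    (hDv : ∀ (μ : Fin P.d) (x x' : HiggsLattice.Site P 0), Good x → Good x' →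
      (P.mesh 0 ^ P.d)⁻¹ * ∑ i' : Ix N, ‖covDeriv C A (T (cb P N 0 (x', i'))) ⟨x, μ⟩‖
        ≤ CD * (P.mesh k * (P.mesh k ^ P.d)⁻¹) * Real.exp (-(δ * ((HiggsLattice.Site.tdist x x' : ℝ) / (P.L : ℝ) ^ k))))
    (hDv' : ∀ (μ : Fin P.d) (x x' : HiggsLattice.Site P 0), Good x → Good x' →
      (P.mesh 0 ^ P.d)⁻¹ * ∑ i' : Ix N, ‖covDeriv C A (T' (cb P N 0 (x', i'))) ⟨x, μ⟩‖
        ≤ CD * (P.mesh k * (P.mesh k ^ P.d)⁻¹) * Real.exp (-(δ * ((HiggsLattice.Site.tdist x x' : ℝ) / (P.L : ℝ) ^ k))))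
    (hH : ∀ (μ : Fin P.d) (x₁ x₂ x' : HiggsLattice.Site P 0) (Γ : List (HiggsLattice.Site P 0)),
      Good x₁ → Good x₂ → Good x' → x₁ ≠ x₂ → IsAdm x₁ x₂ Γ →
      (P.mesh 0 ^ P.d)⁻¹ * ∑ i' : Ix N, ‖hol C A x₁ Γ (covDeriv C A (T (cb P N 0 (x', i'))) ⟨x₂, μ⟩)
          - covDeriv C A (T (cb P N 0 (x', i'))) ⟨x₁, μ⟩‖
        ≤ (P.mesh 0 * (HiggsLattice.Site.tdist x₁ x₂ : ℝ)) ^ α * (CH * (P.mesh k * (P.mesh k ^ P.d)⁻¹ * (P.mesh k ^ α)⁻¹)) *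
          Real.exp (-(δ * (min (HiggsLattice.Site.tdist x₁ x' : ℝ) (HiggsLattice.Site.tdist x₂ x' : ℝ) / (P.L : ℝ) ^ k))))
    (hM' : ∀ (μ ν : Fin P.d) (x x' : HiggsLattice.Site P 0), Good x → Good x' →
      (P.mesh 0 ^ P.d)⁻¹ * ((P.mesh 0)⁻¹ *
          ∑ i : Ix N, ‖covDeriv C A (T' (dip C A ⟨x', ν⟩ (onb N i))) ⟨x, μ⟩‖)
        ≤ CM * (P.mesh k ^ P.d)⁻¹ * Real.exp (-(δ * ((HiggsLattice.Site.tdist x x' : ℝ) / (P.L : ℝ) ^ k))))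
    (hdom : DomG k Good m Sb) (hdom' : DomG k Good m Sy)
    (hsep : ∀ x ∈ Sb, ∀ x' ∈ Sy, (P.L : ℝ) ^ k * D ≤ (HiggsLattice.Site.tdist x x' : ℝ)) :
    (∀ x ∈ Sb, ∀ y ∈ Sy, ‖kv k T x y‖ ≤ (CV + CD) * Real.exp (-(δ * D))) ∧
    (∀ x ∈ Sb, ∀ y ∈ Sy, ∀ μ : Fin P.d, ‖kd k C A T ⟨x, μ⟩ y‖ ≤ (CV + CD) * Real.exp (-(δ * D))) ∧
    (∀ (μ : Fin P.d) (x₁ x₂ y₁ y₂ : HiggsLattice.Site P 0), x₁ ∈ Sb → x₂ ∈ Sb → y₁ ∈ Sy → y₂ ∈ Sy →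
      0 < max (HiggsLattice.Site.tdist x₁ x₂ : ℝ) (HiggsLattice.Site.tdist y₁ y₂ : ℝ) / (P.L : ℝ) ^ k →
      ‖(hol C A x₁ (cpath x₁ x₂)).comp ((kd k C A T ⟨x₂, μ⟩ y₂).comp (star (hol C A y₁ (cpath y₁ y₂))))
          - kd k C A T ⟨x₁, μ⟩ y₁‖
        ≤ (CH + P.d * m * CM) * Real.exp (-(δ * D)) *
            (max (HiggsLattice.Site.tdist x₁ x₂ : ℝ) (HiggsLattice.Site.tdist y₁ y₂ : ℝ) / (P.L : ℝ) ^ k) ^ α) ∧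
    (∀ (x₁ x₂ y₁ y₂ : HiggsLattice.Site P 0), x₁ ∈ Sb → x₂ ∈ Sb → y₁ ∈ Sy → y₂ ∈ Sy →
      ‖(hol C A x₁ (cpath x₁ x₂)).comp ((kv k T x₂ y₂).comp (star (hol C A y₁ (cpath y₁ y₂)))) - kv k T x₁ y₁‖
        ≤ (P.d : ℝ) * (((HiggsLattice.Site.tdist x₁ x₂ : ℝ) + (HiggsLattice.Site.tdist y₁ y₂ : ℝ)) / (P.L : ℝ) ^ k) *
            ((CV + CD) * Real.exp (-(δ * D)))) := by
  have hE : 0 ≤ Real.exp (-(δ * D)) := (Real.exp_pos _).le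
  refine ⟨fun x hx y hy => ?_, fun x hx y hy μ => ?_, fun μ x₁ x₂ y₁ y₂ hx₁ hx₂ hy₁ hy₂ hpos => ?_,
    fun x₁ x₂ y₁ y₂ hx₁ hx₂ hy₁ hy₂ => ?_⟩
  · calc ‖kv k T x y‖ ≤ CV * Real.exp (-(δ * D)) := sup_partG hδ hCV hV hdom hdom' hsep hx hy
      _ ≤ (CV + CD) * Real.exp (-(δ * D)) := mul_le_mul_of_nonneg_right (by linarith) hE
  · calc ‖kd k C A T ⟨x, μ⟩ y‖ ≤ CD * Real.exp (-(δ * D)) := deriv_partG hδ hCD hDv hdom hdom' hsep hx hy μ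
      _ ≤ (CV + CD) * Real.exp (-(δ * D)) := mul_le_mul_of_nonneg_right (by linarith) hE
  · exact holder_coreG hadj hS hα0 hα1 hδ hCH hCM hH hM' hdom hdom' hsep μ hx₁ hx₂ hy₁ hy₂ hpos
  · have h := value_moveG (C := C) (A := A) hadj hS hδ hCD hDv hDv' hdom hdom' hsep hx₁ hx₂ hy₁ hy₂
    refine h.trans (mul_le_mul_of_nonneg_left ?_ (by positivity))
    exact mul_le_mul_of_nonneg_right (by linarith) hE

end Entries

/-! ## §4 `‖(h ⊗ h′)F‖_{1,α}` for the kernel of an adjoint pair and smooth localization functions on a pair of admissible domains -/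

section Smooth

variable {k m : ℕ} {C : ChargeData N} {A : HiggsLattice.VecField P 0} {T T' : Module.End ℝ (ScalarField P 0 N)}
  {Good : HiggsLattice.Site P 0 → Prop} {S S' : Finset (HiggsLattice.Site P 0)} {D : ℝ}

/-- **`‖(h ⊗ h′)F‖_{1,α} ≤ (K(c₁,c₂+2c₁,d,m)(C_V + C_D) + C_H + dmC_M)·e^{−δD}` ON THE WHOLE PRODUCT LATTICE** for the kernel `F(x,y) = kv T x y` of an
adjoint pair `(T, T′)` read through both families, for localization functions `h, h′` of p40's class at exponent `1` supported (with collar) in a pair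
of admissible domains `S, S′` at lattice distance `≥ DL^k`, given the FOUR KERNEL ENTRIES (value, row derivative, transported Hölder difference of the
row derivative, mixed) OF `T` AND OF `T′` at good points with a common rate `δ` — the two-family multiplier `normM2_le` on the four bounds of §3 for the
row family on `(S,S′)` and for the column family (= the row family of `T′`) on `(S′,S)`.
[cite: Balaban1983Higgs3, (2.5) p.424, (1.32) p.420, (1.16) p.414, p.420] -/
theorem normM2_le_of_entries (hadj : ∀ f g : ScalarField P 0 N, siteInner f (T g) = siteInner (T' f) g)
    (hS : ∀ μ, 2 < P.sitesPerDir 0 μ) {α δ CV CD CH CM c₁ c₂ : ℝ} (hα0 : 0 ≤ α) (hα1 : α ≤ 1) (hδ : 0 ≤ δ)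
    (hCV : 0 ≤ CV) (hCD : 0 ≤ CD) (hCH : 0 ≤ CH) (hCM : 0 ≤ CM) (hc₁ : 0 ≤ c₁) (hc₂ : 0 ≤ c₂)
    (hV : ∀ (x x' : HiggsLattice.Site P 0), Good x → Good x' →
      (P.mesh 0 ^ P.d)⁻¹ * ∑ i' : Ix N, ‖T (cb P N 0 (x', i')) x‖
        ≤ CV * (P.mesh k ^ 2 * (P.mesh k ^ P.d)⁻¹) * Real.exp (-(δ * ((HiggsLattice.Site.tdist x x' : ℝ) / (P.L : ℝ) ^ k))))
    (hV' : ∀ (x x' : HiggsLattice.Site P 0), Good x → Good x' →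
      (P.mesh 0 ^ P.d)⁻¹ * ∑ i' : Ix N, ‖T' (cb P N 0 (x', i')) x‖
        ≤ CV * (P.mesh k ^ 2 * (P.mesh k ^ P.d)⁻¹) * Real.exp (-(δ * ((HiggsLattice.Site.tdist x x' : ℝ) / (P.L : ℝ) ^ k))))
    (hDv : ∀ (μ : Fin P.d) (x x' : HiggsLattice.Site P 0), Good x → Good x' →
      (P.mesh 0 ^ P.d)⁻¹ * ∑ i' : Ix N, ‖covDeriv C A (T (cb P N 0 (x', i'))) ⟨x, μ⟩‖
        ≤ CD * (P.mesh k * (P.mesh k ^ P.d)⁻¹) * Real.exp (-(δ * ((HiggsLattice.Site.tdist x x' : ℝ) / (P.L : ℝ) ^ k))))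
    (hDv' : ∀ (μ : Fin P.d) (x x' : HiggsLattice.Site P 0), Good x → Good x' →
      (P.mesh 0 ^ P.d)⁻¹ * ∑ i' : Ix N, ‖covDeriv C A (T' (cb P N 0 (x', i'))) ⟨x, μ⟩‖
        ≤ CD * (P.mesh k * (P.mesh k ^ P.d)⁻¹) * Real.exp (-(δ * ((HiggsLattice.Site.tdist x x' : ℝ) / (P.L : ℝ) ^ k))))
    (hH : ∀ (μ : Fin P.d) (x₁ x₂ x' : HiggsLattice.Site P 0) (Γ : List (HiggsLattice.Site P 0)),
      Good x₁ → Good x₂ → Good x' → x₁ ≠ x₂ → IsAdm x₁ x₂ Γ →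
      (P.mesh 0 ^ P.d)⁻¹ * ∑ i' : Ix N, ‖hol C A x₁ Γ (covDeriv C A (T (cb P N 0 (x', i'))) ⟨x₂, μ⟩)
          - covDeriv C A (T (cb P N 0 (x', i'))) ⟨x₁, μ⟩‖
        ≤ (P.mesh 0 * (HiggsLattice.Site.tdist x₁ x₂ : ℝ)) ^ α * (CH * (P.mesh k * (P.mesh k ^ P.d)⁻¹ * (P.mesh k ^ α)⁻¹)) *
          Real.exp (-(δ * (min (HiggsLattice.Site.tdist x₁ x' : ℝ) (HiggsLattice.Site.tdist x₂ x' : ℝ) / (P.L : ℝ) ^ k))))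
    (hH' : ∀ (μ : Fin P.d) (x₁ x₂ x' : HiggsLattice.Site P 0) (Γ : List (HiggsLattice.Site P 0)),
      Good x₁ → Good x₂ → Good x' → x₁ ≠ x₂ → IsAdm x₁ x₂ Γ →
      (P.mesh 0 ^ P.d)⁻¹ * ∑ i' : Ix N, ‖hol C A x₁ Γ (covDeriv C A (T' (cb P N 0 (x', i'))) ⟨x₂, μ⟩)
          - covDeriv C A (T' (cb P N 0 (x', i'))) ⟨x₁, μ⟩‖
        ≤ (P.mesh 0 * (HiggsLattice.Site.tdist x₁ x₂ : ℝ)) ^ α * (CH * (P.mesh k * (P.mesh k ^ P.d)⁻¹ * (P.mesh k ^ α)⁻¹)) *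
          Real.exp (-(δ * (min (HiggsLattice.Site.tdist x₁ x' : ℝ) (HiggsLattice.Site.tdist x₂ x' : ℝ) / (P.L : ℝ) ^ k))))
    (hM : ∀ (μ ν : Fin P.d) (x x' : HiggsLattice.Site P 0), Good x → Good x' →
      (P.mesh 0 ^ P.d)⁻¹ * ((P.mesh 0)⁻¹ *
          ∑ i : Ix N, ‖covDeriv C A (T (dip C A ⟨x', ν⟩ (onb N i))) ⟨x, μ⟩‖)
        ≤ CM * (P.mesh k ^ P.d)⁻¹ * Real.exp (-(δ * ((HiggsLattice.Site.tdist x x' : ℝ) / (P.L : ℝ) ^ k))))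
    (hM' : ∀ (μ ν : Fin P.d) (x x' : HiggsLattice.Site P 0), Good x → Good x' →
      (P.mesh 0 ^ P.d)⁻¹ * ((P.mesh 0)⁻¹ *
          ∑ i : Ix N, ‖covDeriv C A (T' (dip C A ⟨x', ν⟩ (onb N i))) ⟨x, μ⟩‖)
        ≤ CM * (P.mesh k ^ P.d)⁻¹ * Real.exp (-(δ * ((HiggsLattice.Site.tdist x x' : ℝ) / (P.L : ℝ) ^ k))))
    (hdom : DomG k Good m S) (hdom' : DomG k Good m S') (hD0 : 0 ≤ D)
    (hsep : ∀ x ∈ S, ∀ x' ∈ S', (P.L : ℝ) ^ k * D ≤ (HiggsLattice.Site.tdist x x' : ℝ))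
    {h h' : HiggsLattice.Site P 0 → ℝ} (hh : IsSmoothLoc k c₁ c₂ 1 S h) (hh' : IsSmoothLoc k c₁ c₂ 1 S' h') :
    normM2 C A k (kv k T) (kd k C A T) (kv k T') (kd k C A T') α h h'
      ≤ (smoothConst P.d m c₁ (c₂ + 2 * c₁) * (CV + CD) + (CH + P.d * m * CM)) * Real.exp (-(δ * D)) := by
  have _ := hD0
  have hadj' : ∀ f g : ScalarField P 0 N, siteInner f (T' g) = siteInner (T f) g := adj_symm hadj
  have hsep' : ∀ x ∈ S', ∀ x' ∈ S, (P.L : ℝ) ^ k * D ≤ (HiggsLattice.Site.tdist x x' : ℝ) := by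
    intro x hx x' hx'; rw [tdist_comm]; exact hsep x' hx' x hx
  obtain ⟨bY, bX, bH, bM⟩ := bounds_packG hadj hS hα0 hα1 hδ hCV hCD hCH hCM hV hDv hDv' hH hM' hdom hdom' hsep
  obtain ⟨bY', bX', bH', bM'⟩ := bounds_packG hadj' hS hα0 hα1 hδ hCV hCD hCH hCM hV' hDv' hDv hH' hM hdom' hdom hsep'
  have hhα := isSmoothLoc_of_lip hc₁ hc₂ hα0 hα1 hh
  have hhα' := isSmoothLoc_of_lip hc₁ hc₂ hα0 hα1 hh'
  have hBV : 0 ≤ (CV + CD) * Real.exp (-(δ * D)) := by positivity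
  have hBH : 0 ≤ (CH + P.d * m * CM) * Real.exp (-(δ * D)) := by positivity
  have hmain := normM2_le (C := C) (A := A) (k := k) (m := m) (KV := kv k T) (KD := kd k C A T) (KV' := kv k T') (KD' := kd k C A T')
    hdom.diam hdom'.diam hc₁ (by positivity : 0 ≤ c₂ + 2 * c₁) hα0 hα1 hhα hhα' hBV hBH bY bX bH bM bY' bX' bH' bM'
  refine hmain.trans (le_of_eq ?_)
  ring

end Smooth

end Literature.MathematicalPhysics.QuantumFieldTheory.Balaban1983to89.B3Norm132TwoFamilyMultiplier

end
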